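import Mathlib
import HarnessLib
import Literature.Combinatorics.Additive.FreimanVosperTheorem
import Literature.Combinatorics.Additive.EnergyIntersectionInequalities
import Literature.Combinatorics.Additive.Pollard
import Literature.Combinatorics.Additive.LevSmeliansky

/-!
# Small doubling in `𝔽_p` beyond `2.4`: Freiman's rectification lemma, the Fourier-bias
# criterion, and the Lev–Shkredov theorems `2.59` (sums) and `2.6` (differences)
# (Lev–Shkredov 2020, Lemmas 2–4, Corollary 1, Theorems 3–4)

Topic `Literature/Combinatorics/Additive`.  Cell `mm-stpp` (D-0046), seat `mm-stpp-lit` (gen 14);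
continues `FreimanVosperTheorem.lean` (S82: Freiman's `2.4`-theorem after Nathanson GTM 165 §2.8,
with the half-circle lemma `FreimanVosper.exists_le_card_halfArc` and the exponential-sum
identities `FreimanVosper.sum_norm_sq_expSum`, `FreimanVosper.card_image_affine_add`), using the
tree's energy identities (`EnergyIntersectionInequalities.lean`: Tao–Vu Lemma 2.9,
`addEnergy_eq_sum_inter_mul_inter`; Mathlib `Finset.le_card_add_mul_addEnergy`) and Freiman's
`(3k−4)`-theorem in `ℤ` (`freiman_3k4`, `FreimanThreeKMinusFour.lean`).  Everything here is
PROVED (no named facts).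

Source: V. F. Lev, I. D. Shkredov, *Small doubling in prime-order groups: from 2.4 to 2.6*,
J. Number Theory 217 (2020) 278–291 = arXiv:1912.03483 (held `paper:arxiv-1912.03483`, pp. 3–7
read 2026-08-28).

**Lemma 2 (Freiman; Lev–Shkredov 2020, Lemma 2 — "Freiman's rectification lemma").**  "Suppose
that `p` is a prime, and that a subset `A ⊆ 𝔽_p` satisfies `|A| < p/12` and `|A+A| < K|A| − 3`
with some `2 ≤ K ≤ 3`.  If there is an arithmetic progression in `𝔽_p` with `(p+1)/2` terms,
containing at least `K|A|/3` elements of `A`, then, indeed, the whole set `A` is contained in an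
arithmetic progression with at most `|A+A| − |A| + 1` terms." — `freiman_rectification` (the
hypotheses `2 ≤ K ≤ 3` are not needed and dropped).  Proof as printed in Lev–Shkredov (the five-line
sketch: lift `A' = A ∩ P` into `[0, p/2)`, Freiman `3k−4` in `ℤ`, `A' ⊆ [0, l]` with `l < p/6`,
the Cauchy–Davenport exclusion of any `x ∈ A` with `x + A'` disjoint from `2A'`, and `3k−4` once
more) — which is also steps (4)–(7) of the proof of Nathanson's Theorem 2.10 as formalized in
`FreimanVosperTheorem.lean`; the kernel text below is that proof, transplanted from the half-circle
to an arbitrary progression `u + v·[0, (p+1)/2)`.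

**Corollary 1 (Lev–Shkredov 2020; Freiman).**  "Let `p` be a prime, and suppose that `A ⊆ 𝔽_p`
is a set such that `|A| < p/12` and `|A+A| < K|A| − 3` with some `2 ≤ K ≤ 3`.  If there exists a
nonprincipal character `χ` with `|Â(χ)| ≥ η|A|`, where `η ∈ [0,1]` satisfies `(1+η)/2 ≥ K/3`, then
`A` is contained in an arithmetic progression with at most `|A+A| − |A| + 1` terms." —
`ap_of_large_fourier_coeff` (characters of `𝔽_p` written `x ↦ ψ(ax)`, `ψ = ZMod.stdAddChar`, as in
S82; Lemma 1 = the half-circle lemma `FreimanVosper.exists_le_card_halfArc`, bridged to a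
progression with `(p+1)/2` terms by `FreimanVosper.subset_apFinset_of_halfArc`).

**Theorem 4 (Lev–Shkredov 2020).**  "Let `p` be a prime, and suppose that `A ⊆ 𝔽_p` satisfies
`100 < |A| < 0.0045p`.  If `|A+A| < 2.59|A| − 3`, then `A` is contained in an arithmetic progression
with at most `|A+A| − |A| + 1` terms." — `lev_shkredov_sum` (§"Theorem 4" below).  Proof as printed
(§3, "Proof of Theorem 4"): with `S = A + A`, `A_x = A ∩ (x + A)`, `S_x = S ∩ (x + S)`,
`η|A| = max_{x ≠ 0} |Â(x)|`:
`p⁻¹(|A|²|S|² + η²|A|²(p − |S|)|S|) ≥ p⁻¹ Σ_x |Â(x)|²|Ŝ(x)|² = Σ_x |A_x||S_x| ≥ Σ_{x ∈ A−A} |A_x||A + A_x|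
 ≥ |A|³ + E(A) + |A||S| − 3|A|² + |A| ≥ (1 + 1/K − (3−K)/|A|)|A|³` (`K = |S|/|A|`,
`E(A) ≥ |A|⁴/|S|`, Cauchy–Davenport termwise), and if `η < η₀ := (2/3)·2.59 − 1` this forces
`|A|/p + 0.1296/|A| > 0.0058`, contradicting `|A| < 0.0045p`, `|A| > 100`; so `η ≥ η₀` and
Corollary 1 applies with `K = 2.59`.  Kernel pieces: `LevShkredov.sum_norm_sq_mul_norm_sq_expSum`
(`Σ_x |Â(x)|²|Ŝ(x)|² = p·E(A,S)`), `LevShkredov.card_mul_addEnergy_le` (the upper bound through the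
Fourier bias), `LevShkredov.addEnergy_lower` (the Cauchy–Davenport lower bound), and the final
numerics (exact rational arithmetic; the printed rounded constants `0.1296`, `0.0058` are not used).

**Theorem 3 (Lev–Shkredov 2020).**  "Let `p` be a prime, and suppose that `A ⊆ 𝔽_p` satisfies
`|A| < 0.0045p`.  If `|A−A| < 2.6|A| − 3`, then `A` is contained in an arithmetic progression with
at most `|A−A| − |A| + 1` terms." — `lev_shkredov_diff`, with **Lemma 3** (Schur triples,
`LevShkredov.schur_triples_le` — proved here from the tree's POLLARD theorem rather than from
Lev's rearrangement theorem [b:l], and without the printed parity hypothesis), **Lemma 4** (the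
energy increment `E(A) ≥ (1/K + (1 − |A|⁻²)/(3K(K+2)))|A|³` for `|A − A| = K|A| < p/2`,
`LevShkredov.addEnergy_lower_of_few_differences(')`, via third moments:
`LevShkredov.card_pow_six_le` is the Cauchy–Schwarz step `|A|⁶ ≤ E₃(A)·|{(x,y) ∈ D²: x − y ∈ D}|`),
the difference versions of Lemma 2 / Corollary 1 (`freiman_rectification_sub`,
`ap_of_large_fourier_coeff_sub`, with `FreimanVosper.card_image_affine_sub` and the tree's
`freiman_3k4_add` = Freiman's `3k − 4` theorem for `A + B`, `|A| = |B|`), the corrected chain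
`LevShkredov.addEnergy_sub_lower` and the numerics `LevShkredov.numerics_sub`.

**PRINT CORRECTION (Theorem 3, proof, p. 6 of arXiv:1912.03483).**  The displayed equality
`|A||D| + Σ_{x∈D∖{0}} |A_x|(|A|+|A_x|−1) = |A||D| + (|A|²−|A|)|A| + (E(A)−|A|²) − (|D|−1)` is wrong:
`Σ_{x∈D∖{0}} |A_x| = |A|² − |A|`, not `|D| − 1` (e.g. `A = {0,1,2} ⊂ ℤ/101`: the left side is `22`,
the printed right side `24`); the correct bound is `≥ |A|³ + E(A) + (K−3)|A|² + |A|` (as in the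
proof of Theorem 4), not `> |A|³ + E(A) + (K−2)|A|² − K|A|`.  With the printed substitution
`K → 2.6` the closing computation then fails; it goes through with `K ≤ 2.6 − 3/|A|`, which the
hypothesis `|A−A| < 2.6|A| − 3` provides (`LevShkredov.numerics_sub`: exact rational arithmetic;
the resulting one-variable quartic `N(a)` has `N(5 + t)` with all coefficients negative).  So
THEOREM 3 HOLDS AS STATED; only the printed derivation needs this one-line repair.

NOT FORMALIZED: Theorems 1–2, 5 (Vosper / Freiman 2.4 / Freiman 3k−4: `Vosper.lean`,
`FreimanVosperTheorem.lean`, `FreimanThreeKMinusFour.lean`, `LevSmeliansky.lean`), Theorem 6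
(§4, the asymptotic remark), the intermediate asymptotic display
`η² ≥ 1/K + 1/K² + 1/(3K²(K+2)) + o(1)`.
Census-silent for the cell `mm-stpp` (LIT-INDEX §11 (d): "Lev–Shkredov 2020 … TREE: ABSENT").

## References
* V. F. Lev, I. D. Shkredov, *Small doubling in prime-order groups: from 2.4 to 2.6*, J. Number
  Theory 217 (2020) 278–291, arXiv:1912.03483 — held `paper:arxiv-1912.03483`, pp. 3–7
  [cite: LevShkredov2020, Lemma 2; Lemma 3; Lemma 4; Cor 1; Thm 3; Thm 4].
* G. A. Freĭman, *Foundations of a Structural Theory of Set Addition*, Transl. Math. Monogr. 37,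
  AMS (1973) — origin of Lemmas 1–2 [cite: Freiman1973].
* M. B. Nathanson, *Additive Number Theory: Inverse Problems and the Geometry of Sumsets*, GTM 165
  (1996), Thm 2.9, proof of Thm 2.10 (tree `FreimanVosperTheorem.lean`) [cite: Nathanson1996, Thm 2.10].
* T. Tao, V. Vu, *Additive Combinatorics* (2006), Lemma 2.9 (tree
  `EnergyIntersectionInequalities.lean`) [cite: TaoVu2006, Lemma 2.9].
* J. M. Pollard, *A generalisation of the theorem of Cauchy and Davenport*, J. London Math. Soc. 8
  (1974) 460–462 (tree `Pollard.lean`; used for Lemma 3) [cite: Pollard1974, Thm 1].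
* M. B. Nathanson, GTM 165, Thm 4.8 (Freiman's `3k−4` for `A + B`; tree `LevSmeliansky.lean`,
  `freiman_3k4_add`) [cite: Nathanson1996, Thm 4.8].
-/

open Finset
open scoped Pointwise Real

namespace Literature.Combinatorics.Additive

namespace FreimanVosper

section Rectification

variable {p : ℕ} [hp : Fact p.Prime]

/-- Two integers of `[0, p)` that agree modulo `p` are equal. [folklore] -/
private theorem int_eq_of_zmodCast_eq' {x y : ℤ} (hx0 : 0 ≤ x) (hxp : x < p) (hy0 : 0 ≤ y)
    (hyp : y < p) (h : (x : ZMod p) = y) : x = y := by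
  rw [ZMod.intCast_eq_intCast_iff_dvd_sub] at h
  obtain ⟨q, hq⟩ := h
  have hp0 : (0 : ℤ) < p := by exact_mod_cast hp.out.pos
  rcases lt_trichotomy q 0 with hq0 | hq0 | hq0
  · have hq1 : q ≤ -1 := by omega
    nlinarith
  · rw [hq0, mul_zero, sub_eq_zero] at hq
    exact hq.symm
  · have hq1 : 1 ≤ q := by omega
    nlinarith

/-- **Bridge from the half-circle lemma to a progression with `(p+1)/2` terms.**  If, for
`z ≢ 0`, the fractions `α_a = (az mod p)/p` of the elements of `A' ⊆ ℤ/pℤ` lie in a half-open arc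
`[β, β + 1/2) (mod 1)`, then `A'` is contained in the arithmetic progression
`z⁻¹u₀ + z⁻¹·[0, (p+1)/2)` with `u₀ = ⌈βp⌉` (step (4) of the proof of Nathanson's Theorem 2.10:
`az ≡ u₀ + s_a`, `0 ≤ s_a ≤ (p−1)/2`). [cite: Nathanson1996, Thm 2.10 (proof)]
[cite: LevShkredov2020, Lemma 1 (use)] -/
theorem subset_apFinset_of_halfArc {z : ZMod p} (hz0 : z ≠ 0) (β : ℝ) (A' : Finset (ZMod p))
    (hA' : ∀ a ∈ A', ∃ m : ℤ, β ≤ ((a * z).val : ℝ) / p + m ∧ ((a * z).val : ℝ) / p + m < β + 1 / 2) :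
    A' ⊆ apFinset (z⁻¹ * ((⌈β * p⌉ : ℤ) : ZMod p)) z⁻¹ ((p + 1) / 2) := by
  have hp' := hp.out
  have hp0 : (0 : ℝ) < p := by exact_mod_cast hp'.pos
  set u₀ : ℤ := ⌈β * p⌉ with hu₀
  intro a ha
  obtain ⟨m, hm1, hm2⟩ := hA' a ha
  set n : ℤ := ((a * z).val : ℤ) + m * p with hn
  have hncast : ((n : ℤ) : ℝ) = ((a * z).val : ℝ) / p * p + m * p := by
    rw [hn]
    push_cast
    field_simp
  have hαa : ((a * z).val : ℝ) / p * p = ((a * z).val : ℝ) := by field_simp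
  have hn1 : β * p ≤ n := by
    have := mul_le_mul_of_nonneg_right hm1 hp0.le
    rw [hncast]
    nlinarith
  have hn2 : (n : ℝ) < β * p + p / 2 := by
    have := mul_lt_mul_of_pos_right hm2 hp0
    rw [hncast]
    nlinarith
  have hu₀n : u₀ ≤ n := Int.ceil_le.2 hn1
  have hu₀β : β * p ≤ u₀ := Int.le_ceil _
  have hnu0 : 0 ≤ n - u₀ := by omega
  have hnup2 : (2 : ℝ) * ((n - u₀ : ℤ) : ℝ) < p := by
    push_cast
    linarith
  have hnup2' : 2 * (n - u₀) < p := by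
    have : ((2 * (n - u₀) : ℤ) : ℝ) < p := by push_cast; linarith
    exact_mod_cast this
  -- the index `i = n - u₀ ∈ [0, (p+1)/2)`
  rw [mem_apFinset]
  refine ⟨(n - u₀).toNat, ?_, ?_⟩
  · have h1 : ((n - u₀).toNat : ℤ) = n - u₀ := Int.toNat_of_nonneg hnu0
    have h2 : 2 * ((n - u₀).toNat : ℤ) < p := by rw [h1]; exact hnup2'
    have h3 : 2 * (n - u₀).toNat < p := by exact_mod_cast h2
    omega
  · have h1 : (((n - u₀).toNat : ℕ) : ZMod p) = (n : ZMod p) - (u₀ : ZMod p) := by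
      have h1' : (((n - u₀).toNat : ℕ) : ℤ) = n - u₀ := Int.toNat_of_nonneg hnu0
      have h1'' : (((n - u₀).toNat : ℕ) : ZMod p) = ((((n - u₀).toNat : ℕ) : ℤ) : ZMod p) := by
        push_cast
        rfl
      rw [h1'', h1']
      push_cast
      ring
    have h2 : (n : ZMod p) = a * z := by
      rw [hn]
      push_cast
      rw [ZMod.natCast_zmod_val, ZMod.natCast_self, mul_zero, add_zero]
    rw [nsmul_eq_mul, h1, h2]
    calc z⁻¹ * ((u₀ : ℤ) : ZMod p) + (a * z - ((u₀ : ℤ) : ZMod p)) * z⁻¹ = a * (z * z⁻¹) := by ring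
      _ = a := by rw [mul_inv_cancel₀ hz0, mul_one]

end Rectification

end FreimanVosper

open FreimanVosper

/-! ## Lemma 2: Freiman's rectification lemma -/

/-- **Freiman's rectification lemma** (Lev–Shkredov 2020, **Lemma 2**, attributed to Freiman).
"Suppose that `p` is a prime, and that a subset `A ⊆ 𝔽_p` satisfies `|A| < p/12` and
`|A+A| < K|A| − 3` with some `2 ≤ K ≤ 3`.  If there is an arithmetic progression in `𝔽_p` with
`(p+1)/2` terms, containing at least `K|A|/3` elements of `A`, then, indeed, the whole set `A` is
contained in an arithmetic progression with at most `|A+A| − |A| + 1` terms."  (The progression is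
`apFinset u v ((p+1)/2) = {u + i•v : i < (p+1)/2}`, `v ≠ 0`; the bounds `2 ≤ K ≤ 3` are not used and dropped.)  Proof as
sketched in print = steps (4)–(7) of the tree's `freiman_vosper`: lift `A' = A ∩ P` to integers
`S' ⊂ [0, p/2)` with `|2S'| = |2A'| ≤ |2A| ≤ 3|A'| − 4`; `freiman_3k4` puts `S'` in a progression
of length `≤ 2|A'| − 3`, so `a = u₂ + v₂ t_a`, `t_a ≤ 2k' − 4` on `A'`; Cauchy–Davenport excludes
`4k' − 7 ≤ t_{a*} ≤ p − 2k' + 3` for `a* ∈ A`; hence all of `A` rectifies into `[0, 6k' − 12]`,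
`6k' − 12 < p/2`, and `freiman_3k4` again. [cite: LevShkredov2020, Lemma 2] -/
theorem freiman_rectification {p : ℕ} [hp : Fact p.Prime] {A : Finset (ZMod p)} {K : ℝ}
    (h12 : 12 * #A < p) (h2A : (#(A + A) : ℝ) < K * #A - 3)
    {u v : ZMod p} (hv : v ≠ 0) (hAP : K * #A ≤ 3 * (#(A ∩ apFinset u v ((p + 1) / 2)) : ℝ)) :
    ∃ a d : ZMod p, d ≠ 0 ∧ A ⊆ apFinset a d (#(A + A) - #A + 1) := by
  classical
  have hp' := hp.out
  have hp0 : (0 : ℝ) < p := by exact_mod_cast hp'.pos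
  set A' : Finset (ZMod p) := A ∩ apFinset u v ((p + 1) / 2) with hA'
  have hA'sub : A' ⊆ A := inter_subset_left
  have hk'k : #A' ≤ #A := card_le_card hA'sub
  -- `A` is non-empty and Cauchy–Davenport gives `|2A| ≥ 2|A| − 1`
  have hAne : A.Nonempty := by
    rw [← card_pos]
    by_contra h0
    push Not at h0
    have : #A = 0 := by omega
    have h1 : (#(A + A) : ℝ) < K * #A - 3 := h2A
    rw [this] at h1
    simp at h1
    have : (0 : ℝ) ≤ #(A + A) := by positivity
    linarith
  have hcd0 := ZMod.cauchy_davenport hp' hAne hAne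
  rw [min_eq_right (by omega : #A + #A - 1 ≤ p)] at hcd0
  have hℓk' : #(A + A) + 4 ≤ 3 * #A' := by
    have h' : ((#(A + A) + 3 : ℕ) : ℝ) < ((3 * #A' : ℕ) : ℝ) := by
      push_cast
      have : K * #A ≤ 3 * (#A' : ℝ) := hAP
      linarith
    have := Nat.cast_lt.1 h'
    omega
  have hk'3 : 3 ≤ #A' := by omega
  have h12k' : 12 * #A' ≤ p := by omega
  have hA'ne : A'.Nonempty := card_pos.1 (by omega)
  have hpodd : p % 2 = 1 := by
    rcases hp'.eq_two_or_odd with h2 | h2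
    · omega
    · exact h2
  /- (4) `a = u + s_a • v` with `0 ≤ s_a ≤ (p − 1)/2` for `a ∈ A'` -/
  set sfun : ZMod p → ℤ := fun a => ((((a - u) * v⁻¹).val : ℕ) : ℤ) with hsfun
  have hscast : ∀ a : ZMod p, ((sfun a : ℤ) : ZMod p) = (a - u) * v⁻¹ := by
    intro a
    simp only [hsfun, Int.cast_natCast, ZMod.natCast_zmod_val]
  have hs0 : ∀ a, 0 ≤ sfun a := fun a => by simp only [hsfun]; positivity
  have hsp : ∀ a, sfun a < p := fun a => by simp only [hsfun]; exact_mod_cast ZMod.val_lt _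
  have hslt : ∀ a ∈ A', 2 * sfun a < p := by
    intro a ha
    obtain ⟨i, hi, hia⟩ := mem_apFinset.1 (mem_inter.1 ha).2
    have hip : i < p := by omega
    have hsa : sfun a = i := by
      simp only [hsfun]
      rw [← hia, add_sub_cancel_left, nsmul_eq_mul, mul_assoc, mul_inv_cancel₀ hv, mul_one,
        ZMod.val_natCast, Nat.mod_eq_of_lt hip]
    rw [hsa]
    have : 2 * i < p := by omega
    exact_mod_cast this
  /- the set `S' ⊂ [0, p/2)` of integers and its sumset -/
  set S' : Finset ℤ := A'.image sfun with hS'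
  have hφ₁s : ∀ a : ZMod p, u + v * ((sfun a : ℤ) : ZMod p) = a := by
    intro a
    rw [hscast, mul_comm (a - u), ← mul_assoc, mul_inv_cancel₀ hv, one_mul, add_sub_cancel]
  have hS'A' : S'.image (fun n : ℤ => u + v * (n : ZMod p)) = A' := by
    rw [hS', Finset.image_image]
    have : ((fun n : ℤ => u + v * (n : ZMod p)) ∘ sfun) = id := funext fun a => hφ₁s a
    rw [this, Finset.image_id]
  have hcardS' : #S' = #A' := by
    refine le_antisymm card_image_le ?_
    calc #A' = #(S'.image (fun n : ℤ => u + v * (n : ZMod p))) := by rw [hS'A']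
      _ ≤ #S' := card_image_le
  have hS'bd : ∀ n ∈ S', 0 ≤ n ∧ 2 * n < p := by
    intro n hn
    obtain ⟨a, ha, rfl⟩ := mem_image.1 hn
    exact ⟨hs0 a, hslt a ha⟩
  have hcard2S' : #(S' + S') = #(A' + A') := by
    rw [← card_image_affine_add S' u v hv hS'bd, hS'A']
  have h2S'le : #(S' + S') ≤ #(A + A) := by
    rw [hcard2S']
    exact card_le_card (add_subset_add hA'sub hA'sub)
  /- (5) Freiman `3k − 4` for `S'`: `s_a = a₀ + i_a d` with `i_a ≤ 2k' − 4` -/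
  have h3k4S' : (#(S' + S') : ℤ) ≤ 3 * #S' - 4 := by
    rw [hcardS']
    omega
  obtain ⟨a₀, d, hd, hsubS'⟩ := freiman_3k4 h3k4S'
  have hmemS' : ∀ a ∈ A', ∃ i : ℕ, i < #(S' + S') - #S' + 1 ∧ a₀ + i * d = sfun a := by
    intro a ha
    obtain ⟨i, hi, he⟩ := mem_image.1 (hsubS' (mem_image_of_mem sfun ha))
    exact ⟨i, mem_range.1 hi, he⟩
  have hdp : (d : ZMod p) ≠ 0 := by
    intro hd0
    obtain ⟨a₁, ha₁, a₂, ha₂, hne⟩ := one_lt_card.1 (by omega : 1 < #A')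
    obtain ⟨i₁, _, he₁⟩ := hmemS' a₁ ha₁
    obtain ⟨i₂, _, he₂⟩ := hmemS' a₂ ha₂
    have hcast : ((sfun a₁ : ℤ) : ZMod p) = ((sfun a₂ : ℤ) : ZMod p) := by
      rw [← he₁, ← he₂]
      push_cast
      rw [hd0]
      ring
    have heq := int_eq_of_zmodCast_eq' (p := p) (hs0 a₁) (hsp a₁) (hs0 a₂) (hsp a₂) hcast
    have h1 := hφ₁s a₁
    rw [heq, hφ₁s a₂] at h1
    exact hne h1.symm
  set u₂ : ZMod p := u + v * (a₀ : ZMod p) with hu₂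
  set v₂ : ZMod p := v * (d : ZMod p) with hv₂
  have hv₂0 : v₂ ≠ 0 := mul_ne_zero hv hdp
  set tfun : ZMod p → ℕ := fun a => ((a - u₂) * v₂⁻¹).val with htfun
  have htkey : ∀ a : ZMod p, u₂ + v₂ * (tfun a : ZMod p) = a := by
    intro a
    simp only [htfun, ZMod.natCast_zmod_val]
    rw [mul_comm (a - u₂), ← mul_assoc, mul_inv_cancel₀ hv₂0, one_mul, add_sub_cancel]
  have htlt : ∀ a, tfun a < p := fun a => ZMod.val_lt _
  have htA' : ∀ a ∈ A', tfun a + 4 ≤ 2 * #A' := by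
    intro a ha
    obtain ⟨i, hi, he⟩ := hmemS' a ha
    have ha_eq : a = u₂ + v₂ * (i : ZMod p) := by
      have h1 := hφ₁s a
      rw [← he] at h1
      push_cast at h1
      rw [← h1, hu₂, hv₂]
      ring
    have hip : i < p := by omega
    have hti : tfun a = i := by
      simp only [htfun]
      rw [ha_eq, add_sub_cancel_left, mul_comm v₂ (i : ZMod p), mul_assoc, mul_inv_cancel₀ hv₂0,
        mul_one, ZMod.val_natCast, Nat.mod_eq_of_lt hip]
    omega
  /- (6) the `t*`-argument (Cauchy–Davenport) -/
  have htwindow : ∀ a ∈ A, tfun a + 8 ≤ 4 * #A' ∨ p + 4 ≤ tfun a + 2 * #A' := by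
    intro aS haS
    by_contra hcon
    push Not at hcon
    obtain ⟨hlo, hhi⟩ := hcon
    have hdisj : Disjoint (A' + A') (A' + {aS}) := by
      rw [Finset.disjoint_left]
      intro x hx1 hx2
      obtain ⟨a₁, ha₁, a₂, ha₂, rfl⟩ := mem_add.1 hx1
      obtain ⟨a₃, ha₃, a₄, ha₄, he⟩ := mem_add.1 hx2
      rw [mem_singleton] at ha₄
      rw [ha₄] at he
      have e : ((tfun a₁ + tfun a₂ : ℕ) : ZMod p) = ((tfun a₃ + tfun aS : ℕ) : ZMod p) := by
        have hvv : v₂ * ((tfun a₁ + tfun a₂ : ℕ) : ZMod p) =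
            v₂ * ((tfun a₃ + tfun aS : ℕ) : ZMod p) := by
          have h1 := htkey a₁
          have h2 := htkey a₂
          have h3 := htkey a₃
          have h4 := htkey aS
          push_cast
          linear_combination h1 + h2 - h3 - h4 - he
        exact mul_left_cancel₀ hv₂0 hvv
      rw [ZMod.natCast_eq_natCast_iff'] at e
      have ht₁ := htA' a₁ ha₁
      have ht₂ := htA' a₂ ha₂
      have ht₃ := htA' a₃ ha₃
      rw [Nat.mod_eq_of_lt (by omega), Nat.mod_eq_of_lt (by omega)] at e
      omega
    have hunion : #(A' + A') + #(A' + {aS}) ≤ #(A + A) := by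
      rw [← card_union_of_disjoint hdisj]
      exact card_le_card (union_subset (add_subset_add hA'sub hA'sub)
        (add_subset_add hA'sub (singleton_subset_iff.2 haS)))
    have hcd := ZMod.cauchy_davenport hp' hA'ne hA'ne
    rw [min_eq_right (by omega : #A' + #A' - 1 ≤ p)] at hcd
    rw [card_add_singleton] at hunion
    omega
  /- (7) `a = u₃ + v₂ w_a` with `0 ≤ w_a ≤ 6k' − 12 < p/2`; `freiman_3k4` for `W` -/
  set L : ℤ := 2 * (#A' : ℤ) - 4 with hL
  set wfun : ZMod p → ℤ := fun a =>
    if (tfun a : ℤ) + 8 ≤ 4 * #A' then (tfun a : ℤ) + L else (tfun a : ℤ) + L - p with hwfun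
  have hwbd : ∀ a ∈ A, 0 ≤ wfun a ∧ 2 * wfun a < p := by
    intro a ha
    have ht := htlt a
    rcases htwindow a ha with h | h
    · have h' : (tfun a : ℤ) + 8 ≤ 4 * #A' := by exact_mod_cast h
      have e : wfun a = (tfun a : ℤ) + L := by simp only [hwfun, if_pos h']
      rw [e, hL]
      constructor <;> omega
    · have h' : ¬ ((tfun a : ℤ) + 8 ≤ 4 * #A') := by omega
      have e : wfun a = (tfun a : ℤ) + L - p := by simp only [hwfun, if_neg h']
      rw [e, hL]
      constructor <;> omega
  have hwcast : ∀ a, ((wfun a : ℤ) : ZMod p) = (tfun a : ZMod p) + (L : ZMod p) := by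
    intro a
    by_cases h' : (tfun a : ℤ) + 8 ≤ 4 * #A'
    · have e : wfun a = (tfun a : ℤ) + L := by simp only [hwfun, if_pos h']
      rw [e]
      push_cast
      ring
    · have e : wfun a = (tfun a : ℤ) + L - p := by simp only [hwfun, if_neg h']
      rw [e]
      push_cast
      rw [ZMod.natCast_self]
      ring
  set u₃ : ZMod p := u₂ - v₂ * (L : ZMod p) with hu₃
  have hwkey : ∀ a, u₃ + v₂ * ((wfun a : ℤ) : ZMod p) = a := by
    intro a
    rw [hwcast, hu₃]
    have := htkey a
    linear_combination this
  set W : Finset ℤ := A.image wfun with hW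
  have hWA : W.image (fun n : ℤ => u₃ + v₂ * (n : ZMod p)) = A := by
    rw [hW, Finset.image_image]
    have : ((fun n : ℤ => u₃ + v₂ * (n : ZMod p)) ∘ wfun) = id := funext fun a => hwkey a
    rw [this, Finset.image_id]
  have hcardW : #W = #A := by
    refine le_antisymm card_image_le ?_
    calc #A = #(W.image (fun n : ℤ => u₃ + v₂ * (n : ZMod p))) := by rw [hWA]
      _ ≤ #W := card_image_le
  have hWbd : ∀ n ∈ W, 0 ≤ n ∧ 2 * n < p := by
    intro n hn
    obtain ⟨a, ha, rfl⟩ := mem_image.1 hn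
    exact hwbd a ha
  have hcard2W : #(W + W) = #(A + A) := by
    rw [← card_image_affine_add W u₃ v₂ hv₂0 hWbd, hWA]
  have hℓ3k : #(A + A) + 4 ≤ 3 * #A := by omega
  have h3k4W : (#(W + W) : ℤ) ≤ 3 * #W - 4 := by
    rw [hcard2W, hcardW]
    omega
  obtain ⟨a₁, d₁, _, hsubW⟩ := freiman_3k4 h3k4W
  rw [hcard2W, hcardW] at hsubW
  have hincl : A ⊆ apFinset (u₃ + v₂ * (a₁ : ZMod p)) (v₂ * (d₁ : ZMod p)) (#(A + A) - #A + 1) := by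
    intro x hx
    rw [← hWA] at hx
    obtain ⟨w, hw, rfl⟩ := mem_image.1 hx
    obtain ⟨i, hi, he⟩ := mem_image.1 (hsubW hw)
    rw [mem_apFinset]
    refine ⟨i, mem_range.1 hi, ?_⟩
    rw [← he]
    push_cast
    rw [nsmul_eq_mul]
    ring
  refine ⟨_, _, fun hD => ?_, hincl⟩
  rw [hD] at hincl
  have : #A ≤ 1 := by
    refine card_le_one.2 fun x hx y hy => ?_
    obtain ⟨i, _, hi⟩ := mem_apFinset.1 (hincl hx)
    obtain ⟨j, _, hj⟩ := mem_apFinset.1 (hincl hy)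
    rw [smul_zero, add_zero] at hi hj
    rw [← hi, ← hj]
  omega

/-! ## Corollary 1: a large Fourier coefficient forces a short progression -/

/-- **Lev–Shkredov 2020, Corollary 1** (Freiman; Lemma 1 + Lemma 2).  "Let `p` be a prime, and
suppose that `A ⊆ 𝔽_p` is a set such that `|A| < p/12` and `|A+A| < K|A| − 3` with some
`2 ≤ K ≤ 3`.  If there exists a nonprincipal character `χ ∈ 𝔽̂_p` such that `|Â(χ)| ≥ η|A|`, where
`η ∈ [0,1]` satisfies `(1+η)/2 ≥ K/3`, then `A` is contained in an arithmetic progression with at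
most `|A+A| − |A| + 1` terms."  The nonprincipal characters are `a ↦ ψ(az)`, `z ≢ 0`,
`ψ = ZMod.stdAddChar`; `η ∈ [0,1]` and `2 ≤ K ≤ 3` are not used and dropped.  Proof as printed: the half-circle
lemma (Lemma 1 = tree `FreimanVosper.exists_le_card_halfArc`, Nathanson Thm 2.9) gives an arc with
`≥ (1+η)|A|/2 ≥ K|A|/3` elements, `subset_apFinset_of_halfArc` turns it into a progression with
`(p+1)/2` terms, and `freiman_rectification` concludes. [cite: LevShkredov2020, Cor 1] -/
theorem ap_of_large_fourier_coeff {p : ℕ} [hp : Fact p.Prime] {A : Finset (ZMod p)} {K η : ℝ}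
    (h12 : 12 * #A < p) (h2A : (#(A + A) : ℝ) < K * #A - 3)
    (hηK : K / 3 ≤ (1 + η) / 2) {z : ZMod p} (hz0 : z ≠ 0)
    (hz : η * #A ≤ ‖∑ a ∈ A, (ZMod.stdAddChar (a * z) : ℂ)‖) :
    ∃ a d : ZMod p, d ≠ 0 ∧ A ⊆ apFinset a d (#(A + A) - #A + 1) := by
  classical
  have hp' := hp.out
  -- Lemma 1 (the half-circle lemma) for `α_a = (az mod p)/p`
  set α : ZMod p → ℝ := fun a => ((a * z).val : ℝ) / p with hα
  have hexp : ∀ a : ZMod p,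
      (ZMod.stdAddChar (a * z) : ℂ) = Complex.exp (2 * π * Complex.I * (α a : ℝ)) := by
    intro a
    rw [ZMod.stdAddChar_apply, ZMod.toCircle_apply]
    congr 1
    simp only [hα]
    push_cast
    ring
  have h29 : η * #A ≤ ‖∑ a ∈ A, Complex.exp (2 * π * Complex.I * (α a : ℝ))‖ := by
    simp_rw [← hexp]
    exact hz
  obtain ⟨β, hβ⟩ := exists_le_card_halfArc A α η h29
  set A' : Finset (ZMod p) := A.filter (fun a => ∃ m : ℤ, β ≤ α a + m ∧ α a + m < β + 1 / 2)
    with hA'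
  -- the arc is a progression with `(p+1)/2` terms
  have hsub : A' ⊆ apFinset (z⁻¹ * ((⌈β * p⌉ : ℤ) : ZMod p)) z⁻¹ ((p + 1) / 2) :=
    subset_apFinset_of_halfArc hz0 β A' fun a ha => (mem_filter.1 ha).2
  have hA'sub : A' ⊆ A := filter_subset _ _
  have hcard : (#A' : ℝ) ≤ #(A ∩ apFinset (z⁻¹ * ((⌈β * p⌉ : ℤ) : ZMod p)) z⁻¹ ((p + 1) / 2)) := by
    exact_mod_cast card_le_card (subset_inter hA'sub hsub)
  refine freiman_rectification (u := z⁻¹ * ((⌈β * p⌉ : ℤ) : ZMod p)) h12 h2A (inv_ne_zero hz0) ?_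
  have hk0 : (0 : ℝ) ≤ #A := by positivity
  have e : (1 + η) * #A / 2 ≤ #A' := hβ
  nlinarith

/-! ## The Fourier side: `Σ_x |Â(x)|²|B̂(x)|² = N·E(A,B)` and the bias bound -/

namespace LevShkredov

section Fourier

variable {N : ℕ} [NeZero N]

/-- `conj ψ(j) = ψ(−j)` for `ψ = ZMod.stdAddChar`. [folklore] -/
private theorem conj_stdAddChar' (j : ZMod N) :
    (starRingEnd ℂ) (ZMod.stdAddChar j) = ZMod.stdAddChar (-j) := by
  rw [ZMod.stdAddChar_apply, ZMod.stdAddChar_apply, AddChar.map_neg_eq_inv, Circle.coe_inv_eq_conj]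

/-- Orthogonality `Σ_x ψ(tx) = N·[t = 0]` (Mathlib `AddChar.sum_mulShift`). [folklore] -/
private theorem sum_stdAddChar_mul_eq_ite' (t : ZMod N) :
    ∑ x : ZMod N, (ZMod.stdAddChar (t * x) : ℂ) = if t = 0 then (N : ℂ) else 0 := by
  have h := AddChar.sum_mulShift t (ZMod.isPrimitive_stdAddChar N)
  simp_rw [mul_comm _ t] at h
  rw [h, ZMod.card, Nat.cast_ite, Nat.cast_zero]

/-- `|S_A(x)|² = Σ_{a, a' ∈ A} ψ((a − a')x)`. [folklore] -/
private theorem norm_sq_expSum_eq (A : Finset (ZMod N)) (x : ZMod N) :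
    (((‖∑ a ∈ A, (ZMod.stdAddChar (a * x) : ℂ)‖ ^ 2 : ℝ)) : ℂ) =
      ∑ a ∈ A, ∑ a' ∈ A, (ZMod.stdAddChar ((a - a') * x) : ℂ) := by
  rw [Complex.ofReal_pow, ← Complex.mul_conj', map_sum, Finset.sum_mul_sum]
  refine Finset.sum_congr rfl fun a _ => Finset.sum_congr rfl fun a' _ => ?_
  rw [conj_stdAddChar', ← AddChar.map_add_eq_mul]
  congr 1
  ring

omit [NeZero N] in
/-- The additive energy `E(A,B) = |{(a, a', b, b') ∈ A² × B² : a + b = a' + b'}|` (Mathlib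
`Finset.addEnergy`) written as a fourfold indicator sum. [folklore] -/
private theorem addEnergy_eq_sum_ite (A B : Finset (ZMod N)) :
    ((A.addEnergy B : ℕ) : ℂ) =
      ∑ a ∈ A, ∑ a' ∈ A, ∑ b ∈ B, ∑ b' ∈ B, if a + b = a' + b' then (1 : ℂ) else 0 := by
  rw [Finset.addEnergy, Finset.card_filter]
  push_cast
  simp only [Finset.sum_product]

/-- **The Fourier expression of the energy** (used in Lev–Shkredov's chain
`p⁻¹ Σ_χ |Â(χ)|²|Ŝ(χ)|² = Σ_x |A_x||S_x|`): for `A, B ⊆ ℤ/Nℤ`,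
`Σ_{x mod N} |S_A(x)|²|S_B(x)|² = N·E(A,B)` with `S_A(x) = Σ_{a∈A} ψ(ax)`.
[cite: LevShkredov2020, Thm 4 (proof)] -/
theorem sum_norm_sq_mul_norm_sq_expSum (A B : Finset (ZMod N)) :
    ∑ x : ZMod N, ‖∑ a ∈ A, (ZMod.stdAddChar (a * x) : ℂ)‖ ^ 2 *
        ‖∑ b ∈ B, (ZMod.stdAddChar (b * x) : ℂ)‖ ^ 2 = (N : ℝ) * A.addEnergy B := by
  have h : (((∑ x : ZMod N, ‖∑ a ∈ A, (ZMod.stdAddChar (a * x) : ℂ)‖ ^ 2 *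
        ‖∑ b ∈ B, (ZMod.stdAddChar (b * x) : ℂ)‖ ^ 2 : ℝ)) : ℂ) = (N : ℂ) * ((A.addEnergy B : ℕ) : ℂ) := by
    calc (((∑ x : ZMod N, ‖∑ a ∈ A, (ZMod.stdAddChar (a * x) : ℂ)‖ ^ 2 *
        ‖∑ b ∈ B, (ZMod.stdAddChar (b * x) : ℂ)‖ ^ 2 : ℝ)) : ℂ)
        = ∑ x : ZMod N, (((‖∑ a ∈ A, (ZMod.stdAddChar (a * x) : ℂ)‖ ^ 2 : ℝ)) : ℂ) *
            (((‖∑ b ∈ B, (ZMod.stdAddChar (b * x) : ℂ)‖ ^ 2 : ℝ)) : ℂ) := by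
          push_cast
          rfl
      _ = ∑ x : ZMod N, (∑ a ∈ A, ∑ a' ∈ A, (ZMod.stdAddChar ((a - a') * x) : ℂ)) *
            (∑ b ∈ B, ∑ b' ∈ B, (ZMod.stdAddChar ((b - b') * x) : ℂ)) :=
          Finset.sum_congr rfl fun x _ => by rw [norm_sq_expSum_eq, norm_sq_expSum_eq]
      _ = ∑ x : ZMod N, ∑ a ∈ A, ∑ a' ∈ A, ∑ b ∈ B, ∑ b' ∈ B,
            (ZMod.stdAddChar ((a - a' + (b - b')) * x) : ℂ) := by
          refine Finset.sum_congr rfl fun x _ => ?_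
          rw [Finset.sum_mul_sum]
          refine Finset.sum_congr rfl fun a _ => ?_
          rw [Finset.sum_comm]
          refine Finset.sum_congr rfl fun a' _ => ?_
          rw [Finset.sum_mul_sum]
          refine Finset.sum_congr rfl fun b _ => Finset.sum_congr rfl fun b' _ => ?_
          rw [← AddChar.map_add_eq_mul]
          congr 1
          ring
      _ = ∑ a ∈ A, ∑ a' ∈ A, ∑ b ∈ B, ∑ b' ∈ B, ∑ x : ZMod N,
            (ZMod.stdAddChar ((a - a' + (b - b')) * x) : ℂ) := by
          rw [Finset.sum_comm]
          refine Finset.sum_congr rfl fun a _ => ?_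
          rw [Finset.sum_comm]
          refine Finset.sum_congr rfl fun a' _ => ?_
          rw [Finset.sum_comm]
          refine Finset.sum_congr rfl fun b _ => ?_
          exact Finset.sum_comm
      _ = ∑ a ∈ A, ∑ a' ∈ A, ∑ b ∈ B, ∑ b' ∈ B,
            if a - a' + (b - b') = 0 then (N : ℂ) else 0 := by
          simp_rw [sum_stdAddChar_mul_eq_ite']
      _ = (N : ℂ) * ∑ a ∈ A, ∑ a' ∈ A, ∑ b ∈ B, ∑ b' ∈ B,
            if a + b = a' + b' then (1 : ℂ) else 0 := by
          rw [Finset.mul_sum]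
          refine Finset.sum_congr rfl fun a _ => ?_
          rw [Finset.mul_sum]
          refine Finset.sum_congr rfl fun a' _ => ?_
          rw [Finset.mul_sum]
          refine Finset.sum_congr rfl fun b _ => ?_
          rw [Finset.mul_sum]
          refine Finset.sum_congr rfl fun b' _ => ?_
          have : (a - a' + (b - b') = 0) ↔ (a + b = a' + b') := by
            rw [sub_add_sub_comm, sub_eq_zero]
          by_cases hc : a + b = a' + b'
          · rw [if_pos (this.2 hc), if_pos hc, mul_one]
          · rw [if_neg (fun h => hc (this.1 h)), if_neg hc, mul_zero]
      _ = (N : ℂ) * ((A.addEnergy B : ℕ) : ℂ) := by rw [addEnergy_eq_sum_ite]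
  exact_mod_cast h

/-- **The upper bound through the Fourier bias** (the first two lines of Lev–Shkredov's chain):
if `|S_A(x)| ≤ θ|A|` for every `x ≢ 0` then
`N·E(A,B) ≤ |A|²|B|² + θ²|A|²(|B|N − |B|²)` — split off `x = 0` and use Parseval
`Σ_x |S_B(x)|² = |B|N` (tree `FreimanVosper.sum_norm_sq_expSum`).
[cite: LevShkredov2020, Thm 4 (proof)] -/
theorem card_mul_addEnergy_le (A B : Finset (ZMod N)) {θ : ℝ}
    (hA : ∀ x : ZMod N, x ≠ 0 → ‖∑ a ∈ A, (ZMod.stdAddChar (a * x) : ℂ)‖ ≤ θ * #A) :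
    (N : ℝ) * A.addEnergy B ≤
      (#A : ℝ) ^ 2 * #B ^ 2 + θ ^ 2 * #A ^ 2 * (#B * N - #B ^ 2) := by
  classical
  set SA : ZMod N → ℂ := fun x => ∑ a ∈ A, (ZMod.stdAddChar (a * x) : ℂ) with hSA
  set SB : ZMod N → ℂ := fun x => ∑ b ∈ B, (ZMod.stdAddChar (b * x) : ℂ) with hSB
  have hSA0 : SA 0 = #A := by simp [hSA]
  have hSB0 : SB 0 = #B := by simp [hSB]
  have hid : ∑ x : ZMod N, ‖SA x‖ ^ 2 * ‖SB x‖ ^ 2 = (N : ℝ) * A.addEnergy B := by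
    simp only [hSA, hSB]
    exact sum_norm_sq_mul_norm_sq_expSum A B
  have hPB : ∑ x : ZMod N, ‖SB x‖ ^ 2 = #B * N := by
    simp only [hSB]
    exact sum_norm_sq_expSum B
  -- split off `x = 0`
  have hsplit := Finset.sum_erase_add (Finset.univ : Finset (ZMod N))
    (fun x => ‖SA x‖ ^ 2 * ‖SB x‖ ^ 2) (Finset.mem_univ 0)
  have hsplitB := Finset.sum_erase_add (Finset.univ : Finset (ZMod N))
    (fun x => ‖SB x‖ ^ 2) (Finset.mem_univ 0)
  rw [hid, hSA0, hSB0] at hsplit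
  rw [hPB, hSB0] at hsplitB
  simp only [Complex.norm_natCast] at hsplit hsplitB
  -- bound the non-zero frequencies
  have hrest : ∑ x ∈ Finset.univ.erase (0 : ZMod N), ‖SA x‖ ^ 2 * ‖SB x‖ ^ 2 ≤
      (θ * #A) ^ 2 * ∑ x ∈ Finset.univ.erase (0 : ZMod N), ‖SB x‖ ^ 2 := by
    rw [Finset.mul_sum]
    refine Finset.sum_le_sum fun x hx => ?_
    have hx0 : x ≠ 0 := Finset.ne_of_mem_erase hx
    have h1 : ‖SA x‖ ≤ θ * #A := hA x hx0
    have h2 : ‖SA x‖ ^ 2 ≤ (θ * #A) ^ 2 := by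
      exact pow_le_pow_left₀ (norm_nonneg _) h1 2
    exact mul_le_mul_of_nonneg_right h2 (by positivity)
  have hB' : ∑ x ∈ Finset.univ.erase (0 : ZMod N), ‖SB x‖ ^ 2 = #B * N - (#B : ℝ) ^ 2 := by
    linarith
  rw [hB'] at hrest
  linarith [hrest, hsplit]

end Fourier

/-! ## The combinatorial side: Cauchy–Davenport termwise -/

section Lower

variable {p : ℕ} [hp : Fact p.Prime]

/-- `A + A_z ⊆ S_z` where `A_z = A ∩ (z + A)`, `S = A + A`, `S_z = S ∩ (z + S)` (the inclusion
`|A + A_x| ≤ |S_x|` of the printed proof). [cite: LevShkredov2020, Thm 4 (proof)] -/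
theorem add_inter_vadd_subset (A : Finset (ZMod p)) (z : ZMod p) :
    A + A ∩ (z +ᵥ A) ⊆ (A + A) ∩ (z +ᵥ (A + A)) := by
  intro x hx
  obtain ⟨a, ha, b, hb, rfl⟩ := mem_add.1 hx
  obtain ⟨hbA, hbz⟩ := mem_inter.1 hb
  obtain ⟨c, hc, hcb⟩ := mem_vadd_finset.1 hbz
  refine mem_inter.2 ⟨add_mem_add ha hbA, mem_vadd_finset.2 ⟨a + c, add_mem_add ha hc, ?_⟩⟩
  rw [← hcb, vadd_eq_add, vadd_eq_add]
  ring

/-- **The lower bound of Lev–Shkredov's chain** (proof of Theorem 4): for non-empty `A ⊆ 𝔽_p`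
with `2|A| ≤ p` and `S = A + A`,
`Σ_x |A_x||S_x| = E(A,S) ≥ |A|³ + E(A) + |A||S| − 3|A|² + |A|`, written without subtraction.
Ingredients as printed: `E(A,S) = Σ_{x ∈ A−A} |A_x||S_x|` (tree `addEnergy_eq_sum_inter_mul_inter`,
with `(A−A) ∩ (S−S) = A−A`), `|S_x| ≥ |A + A_x| ≥ |A| + |A_x| − 1` for `x ≠ 0` (Cauchy–Davenport,
Mathlib `ZMod.cauchy_davenport`), the term `x = 0` equal to `|A||S|`, and
`Σ_{x∈A−A} |A_x| = |A|²`, `Σ_{x∈A−A} |A_x|² = E(A)` (tree `sum_card_inter_vadd_eq`,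
`addEnergy_eq_sum_inter_mul_inter`). [cite: LevShkredov2020, Thm 4 (proof)] -/
theorem addEnergy_lower {A : Finset (ZMod p)} (hA : A.Nonempty) (h2 : 2 * #A ≤ p) :
    #A ^ 3 + A.addEnergy A + #A + #A * #(A + A) ≤ A.addEnergy (A + A) + 3 * #A ^ 2 := by
  classical
  have hp' := hp.out
  set S := A + A with hS
  set D := A - A with hD
  obtain ⟨a₀, ha₀⟩ := hA
  have h0D : (0 : ZMod p) ∈ D := by
    rw [hD, ← sub_self a₀]
    exact sub_mem_sub ha₀ ha₀
  have hDS : D ∩ (S - S) = D := by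
    refine inter_eq_left.2 fun z hz => ?_
    obtain ⟨a, ha, a', ha', rfl⟩ := mem_sub.1 hz
    have : a - a' = (a + a₀) - (a' + a₀) := by ring
    rw [this]
    exact sub_mem_sub (add_mem_add ha ha₀) (add_mem_add ha' ha₀)
  -- the two energies as sums over `z ∈ A − A`
  have hE : A.addEnergy S = ∑ z ∈ D, #(A ∩ (z +ᵥ A)) * #(S ∩ (z +ᵥ S)) := by
    rw [addEnergy_eq_sum_inter_mul_inter, hDS]
  have hEA : A.addEnergy A = ∑ z ∈ D, #(A ∩ (z +ᵥ A)) * #(A ∩ (z +ᵥ A)) := by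
    rw [addEnergy_eq_sum_inter_mul_inter, inter_self]
  have hsum : ∑ z ∈ D, #(A ∩ (z +ᵥ A)) = #A * #A := sum_card_inter_vadd_eq A A
  -- the terms at `z = 0`
  have hA0 : A ∩ ((0 : ZMod p) +ᵥ A) = A := by rw [zero_vadd, inter_self]
  have hS0 : S ∩ ((0 : ZMod p) +ᵥ S) = S := by rw [zero_vadd, inter_self]
  -- termwise Cauchy–Davenport for `z ≠ 0`
  have hterm : ∀ z ∈ D.erase 0,
      #(A ∩ (z +ᵥ A)) * (#A + #(A ∩ (z +ᵥ A))) ≤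
        #(A ∩ (z +ᵥ A)) * #(S ∩ (z +ᵥ S)) + #(A ∩ (z +ᵥ A)) := by
    intro z hz
    have hzD : z ∈ D := mem_of_mem_erase hz
    obtain ⟨a, ha, a', ha', haz⟩ := mem_sub.1 hzD
    have hAz : (A ∩ (z +ᵥ A)).Nonempty := by
      refine ⟨a, mem_inter.2 ⟨ha, mem_vadd_finset.2 ⟨a', ha', ?_⟩⟩⟩
      rw [← haz, vadd_eq_add, sub_add_cancel]
    have hle : #(A ∩ (z +ᵥ A)) ≤ #A := card_le_card inter_subset_left
    have hcd := ZMod.cauchy_davenport hp' ⟨a, ha⟩ hAz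
    rw [min_eq_right (by omega : #A + #(A ∩ (z +ᵥ A)) - 1 ≤ p)] at hcd
    have hsub : #(A + A ∩ (z +ᵥ A)) ≤ #(S ∩ (z +ᵥ S)) :=
      card_le_card (add_inter_vadd_subset A z)
    have h1 : #A + #(A ∩ (z +ᵥ A)) ≤ #(S ∩ (z +ᵥ S)) + 1 := by omega
    calc #(A ∩ (z +ᵥ A)) * (#A + #(A ∩ (z +ᵥ A)))
        ≤ #(A ∩ (z +ᵥ A)) * (#(S ∩ (z +ᵥ S)) + 1) := Nat.mul_le_mul_left _ h1
      _ = #(A ∩ (z +ᵥ A)) * #(S ∩ (z +ᵥ S)) + #(A ∩ (z +ᵥ A)) := by ring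
  have hXY : ∑ z ∈ D.erase 0, #(A ∩ (z +ᵥ A)) * (#A + #(A ∩ (z +ᵥ A))) ≤
      ∑ z ∈ D.erase 0, #(A ∩ (z +ᵥ A)) * #(S ∩ (z +ᵥ S)) +
        ∑ z ∈ D.erase 0, #(A ∩ (z +ᵥ A)) := by
    rw [← sum_add_distrib]
    exact sum_le_sum hterm
  -- reinsert the terms at `z = 0`
  have e1 := sum_erase_add D (fun z => #(A ∩ (z +ᵥ A)) * #(S ∩ (z +ᵥ S))) h0D
  have e2 := sum_erase_add D (fun z => #(A ∩ (z +ᵥ A))) h0D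
  have e3 := sum_erase_add D (fun z => #(A ∩ (z +ᵥ A)) * (#A + #(A ∩ (z +ᵥ A)))) h0D
  simp only [hA0, hS0] at e1 e2 e3
  have e4 : ∑ z ∈ D, #(A ∩ (z +ᵥ A)) * (#A + #(A ∩ (z +ᵥ A))) =
      #A * (#A * #A) + A.addEnergy A := by
    rw [hEA, ← hsum, mul_sum, ← sum_add_distrib]
    refine sum_congr rfl fun z _ => ?_
    ring
  rw [hE]
  linarith [hXY, e1, e2, e3, e4, hsum]

end Lower

/-! ## The numerics of the proof of Theorem 4 -/

/-- The final computation of the proof of Theorem 4, in exact arithmetic.  With `a = |A|`,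
`s = |A+A|`, `e = E(A)`, `f = E(A, A+A)`, `η₀ = (2/3)·2.59 − 1 = 109/150`: the Fourier upper
bound `p f ≤ a²s² + η₀²a²(sp − s²)`, the Cauchy–Davenport lower bound
`a³ + e + a + as ≤ f + 3a²`, Cauchy–Schwarz `a⁴ ≤ s e`, and `2a − 1 ≤ s ≤ 2.59a − 3`,
`101 ≤ a ≤ 0.0045 p` are contradictory ("computing numerically, we obtain
`α + 0.1296/|A| > 0.0058`, contradicting the assumptions").  Our route: the three bounds give
`p·M ≤ (1 − η₀²) a² s³` for `M = sa³ + a⁴ + as + as² − 3a²s − η₀²a²s²`, hence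
`M ≤ 0.0045(1 − η₀²) a s³`; but `M/a − 0.0045(1 − η₀²)s³ ≥ a³ + sa² − 3as + s + (1 − 0.5336a)s² > 0`
on `2a − 1 ≤ s ≤ 2.59a − 3` (a concave quadratic in `s`, positive at both ends).
[cite: LevShkredov2020, Thm 4 (proof)] -/
theorem numerics {a s e f p : ℝ} (hp : 0 < p) (ha : 101 ≤ a) (hs1 : 2 * a - 1 ≤ s)
    (hs2 : s ≤ 2.59 * a - 3) (hap : a ≤ 0.0045 * p)
    (h1 : p * f ≤ a ^ 2 * s ^ 2 + (109 / 150) ^ 2 * a ^ 2 * (s * p - s ^ 2))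
    (h2 : a ^ 3 + e + a + a * s ≤ f + 3 * a ^ 2) (h3 : a ^ 4 ≤ s * e) : False := by
  have hs0 : 0 < s := by linarith
  have ha0 : 0 < a := by linarith
  -- the quantity `M`
  set M : ℝ := s * a ^ 3 + a ^ 4 + a * s + a * s ^ 2 - 3 * a ^ 2 * s -
    (109 / 150) ^ 2 * a ^ 2 * s ^ 2 with hM
  -- Step 1: `p M ≤ (1 − η₀²) a² s³`
  have hB : p * M ≤ (1 - (109 / 150) ^ 2) * a ^ 2 * s ^ 3 := by
    have e1 : p * (a ^ 3 + e + a + a * s - 3 * a ^ 2) ≤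
        a ^ 2 * s ^ 2 + (109 / 150) ^ 2 * a ^ 2 * (s * p - s ^ 2) := by
      have := mul_le_mul_of_nonneg_left h2 hp.le
      linarith
    have e2 : p * a ^ 4 ≤ p * (s * e) := mul_le_mul_of_nonneg_left h3 hp.le
    have e3 := mul_le_mul_of_nonneg_left e1 hs0.le
    rw [hM]
    linarith [e2, e3]
  -- Step 2: `M ≤ 0.0045 (1 − η₀²) a s³`
  have hpos : (0 : ℝ) < 1 - (109 / 150) ^ 2 := by norm_num
  have hC : M ≤ 0.0045 * (1 - (109 / 150) ^ 2) * a * s ^ 3 := by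
    have hrhs : 0 ≤ 0.0045 * (1 - (109 / 150) ^ 2) * a * s ^ 3 :=
      mul_nonneg (mul_nonneg (mul_nonneg (by norm_num) hpos.le) ha0.le) (pow_nonneg hs0.le 3)
    by_cases hM0 : 0 ≤ M
    · have t1 : a * M ≤ 0.0045 * p * M := mul_le_mul_of_nonneg_right hap hM0
      have t2 : a * M ≤ a * (0.0045 * (1 - (109 / 150) ^ 2) * a * s ^ 3) := by
        linarith [t1, hB]
      exact le_of_mul_le_mul_left t2 ha0
    · push Not at hM0
      linarith
  -- Step 3: `M > 0.0045 (1 − η₀²) a s³`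
  have hD : 0.0045 * (1 - (109 / 150) ^ 2) * a * s ^ 3 < M := by
    -- the concave quadratic `Q(s) = a³ + sa² − 3as + s + (1 − 0.5336a)s²` is positive
    have hκ : 0 ≤ 0.5336 * a - 1 := by linarith
    have hl : 0 ≤ s - (2 * a - 1) := by linarith
    have hr : 0 ≤ 2.59 * a - 3 - s := by linarith
    have hgap : 0 < (2.59 * a - 3) - (2 * a - 1) := by linarith
    have haa : 101 * a ≤ a * a := mul_le_mul_of_nonneg_right ha ha0.le
    have haaa : 101 * (a * a) ≤ a * (a * a) := mul_le_mul_of_nonneg_right ha (by positivity)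
    have ha3 : 0 < a * (a * a) := by positivity
    have V1 : 0 < a ^ 3 + (2.59 * a - 3) * a ^ 2 - 3 * a * (2.59 * a - 3) + (2.59 * a - 3) +
        (1 - 0.5336 * a) * (2.59 * a - 3) ^ 2 := by
      linarith [haa, haaa, ha3]
    have V2 : 0 < a ^ 3 + (2 * a - 1) * a ^ 2 - 3 * a * (2 * a - 1) + (2 * a - 1) +
        (1 - 0.5336 * a) * (2 * a - 1) ^ 2 := by
      linarith [haa, haaa, ha3]
    have hQ : 0 < a ^ 3 + s * a ^ 2 - 3 * a * s + s + (1 - 0.5336 * a) * s ^ 2 := by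
      -- chord argument: `(s₂ − s₁) Q(s) = (s₂−s₁)(κa−1)(s−s₁)(s₂−s) + (s₂−s)Q(s₁) + (s−s₁)Q(s₂)`
      have hchord : ((2.59 * a - 3) - (2 * a - 1)) *
          (a ^ 3 + s * a ^ 2 - 3 * a * s + s + (1 - 0.5336 * a) * s ^ 2) =
          ((2.59 * a - 3) - (2 * a - 1)) * ((0.5336 * a - 1) * (s - (2 * a - 1)) *
            (2.59 * a - 3 - s)) +
          (2.59 * a - 3 - s) * (a ^ 3 + (2 * a - 1) * a ^ 2 - 3 * a * (2 * a - 1) + (2 * a - 1) +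
            (1 - 0.5336 * a) * (2 * a - 1) ^ 2) +
          (s - (2 * a - 1)) * (a ^ 3 + (2.59 * a - 3) * a ^ 2 - 3 * a * (2.59 * a - 3) +
            (2.59 * a - 3) + (1 - 0.5336 * a) * (2.59 * a - 3) ^ 2) := by
        ring
      have t1 : 0 ≤ ((2.59 * a - 3) - (2 * a - 1)) * ((0.5336 * a - 1) * (s - (2 * a - 1)) *
            (2.59 * a - 3 - s)) := mul_nonneg hgap.le (mul_nonneg (mul_nonneg hκ hl) hr)
      have t2 : 0 < (2.59 * a - 3 - s) * (a ^ 3 + (2 * a - 1) * a ^ 2 - 3 * a * (2 * a - 1) +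
            (2 * a - 1) + (1 - 0.5336 * a) * (2 * a - 1) ^ 2) +
          (s - (2 * a - 1)) * (a ^ 3 + (2.59 * a - 3) * a ^ 2 - 3 * a * (2.59 * a - 3) +
            (2.59 * a - 3) + (1 - 0.5336 * a) * (2.59 * a - 3) ^ 2) := by
        rcases le_or_gt s ((2 * a - 1 + (2.59 * a - 3)) / 2) with hmid | hmid
        · have : 0 < 2.59 * a - 3 - s := by linarith
          exact add_pos_of_pos_of_nonneg (mul_pos this V2) (mul_nonneg hl V1.le)
        · have : 0 < s - (2 * a - 1) := by linarith
          exact add_pos_of_nonneg_of_pos (mul_nonneg hr V2.le) (mul_pos this V1)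
      have hprod : 0 < ((2.59 * a - 3) - (2 * a - 1)) *
          (a ^ 3 + s * a ^ 2 - 3 * a * s + s + (1 - 0.5336 * a) * s ^ 2) := by
        rw [hchord, add_assoc]
        exact add_pos_of_nonneg_of_pos t1 t2
      exact pos_of_mul_pos_right hprod hgap.le
    -- absorb the cubic term: `η₀² a s² + 0.002124 s³ ≤ 0.5336 a s²`
    have hs3 : s ^ 3 ≤ 2.59 * a * s ^ 2 := by
      have h' : s ≤ 2.59 * a := by linarith
      calc s ^ 3 = s * s ^ 2 := by ring
        _ ≤ 2.59 * a * s ^ 2 := mul_le_mul_of_nonneg_right h' (sq_nonneg s)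
    have hcs : (109 / 150) ^ 2 * a * s ^ 2 + 0.002124 * s ^ 3 ≤ 0.5336 * a * s ^ 2 := by
      linarith [hs3, mul_nonneg ha0.le (sq_nonneg s)]
    have hc : 0.0045 * (1 - (109 / 150 : ℝ) ^ 2) ≤ 0.002124 := by norm_num
    have t3 : 0.0045 * (1 - (109 / 150 : ℝ) ^ 2) * (a * s ^ 3) ≤ 0.002124 * (a * s ^ 3) :=
      mul_le_mul_of_nonneg_right hc (by positivity)
    have t4 := mul_le_mul_of_nonneg_left hcs ha0.le
    have t5 := mul_pos ha0 hQ
    rw [hM]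
    linarith [t3, t4, t5]
  linarith

end LevShkredov

/-! ## Theorem 4 -/

/-- **Lev–Shkredov 2020, Theorem 4.**  "Let `p` be a prime, and suppose that `A ⊆ 𝔽_p` satisfies
`100 < |A| < 0.0045p`.  If `|A+A| < 2.59|A| − 3`, then `A` is contained in an arithmetic progression
with at most `|A+A| − |A| + 1` terms."  Proof as printed: if some nonprincipal Fourier coefficient
has `|Â(z)| ≥ η₀|A|`, `η₀ = (2/3)·2.59 − 1`, Corollary 1 (`ap_of_large_fourier_coeff`, `K = 2.59`)
concludes; otherwise `LevShkredov.card_mul_addEnergy_le` (Fourier side),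
`LevShkredov.addEnergy_lower` (Cauchy–Davenport side), `E(A) ≥ |A|⁴/|A+A|`
(Mathlib `Finset.le_card_add_mul_addEnergy`) and `LevShkredov.numerics` are contradictory.
[cite: LevShkredov2020, Thm 4] -/
theorem lev_shkredov_sum {p : ℕ} [hp : Fact p.Prime] {A : Finset (ZMod p)}
    (h100 : 100 < #A) (hAp : (#A : ℝ) < 0.0045 * p) (h2A : (#(A + A) : ℝ) < 2.59 * #A - 3) :
    ∃ a d : ZMod p, d ≠ 0 ∧ A ⊆ apFinset a d (#(A + A) - #A + 1) := by
  classical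
  have hp' := hp.out
  have h12 : 12 * #A < p := by
    have : (12 : ℝ) * #A < p := by linarith
    exact_mod_cast this
  by_cases hbias : ∃ z : ZMod p, z ≠ 0 ∧
      (109 / 150 : ℝ) * #A ≤ ‖∑ a ∈ A, (ZMod.stdAddChar (a * z) : ℂ)‖
  · obtain ⟨z, hz0, hz⟩ := hbias
    exact ap_of_large_fourier_coeff (K := 2.59) (η := 109 / 150) h12 h2A (by norm_num) hz0 hz
  · push Not at hbias
    exfalso
    have hθ : ∀ x : ZMod p, x ≠ 0 → ‖∑ a ∈ A, (ZMod.stdAddChar (a * x) : ℂ)‖ ≤ (109 / 150 : ℝ) * #A :=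
      fun x hx => (hbias x hx).le
    have hU := LevShkredov.card_mul_addEnergy_le A (A + A) hθ
    have hAne : A.Nonempty := card_pos.1 (by omega)
    have hL := LevShkredov.addEnergy_lower hAne (by omega : 2 * #A ≤ p)
    have hCS := Finset.le_card_add_mul_addEnergy A A
    have hcd := ZMod.cauchy_davenport hp' hAne hAne
    rw [min_eq_right (by omega : #A + #A - 1 ≤ p)] at hcd
    -- cast everything to `ℝ`
    have hL' : ((#A : ℝ)) ^ 3 + (A.addEnergy A : ℝ) + #A + #A * #(A + A) ≤
        (A.addEnergy (A + A) : ℝ) + 3 * (#A : ℝ) ^ 2 := by exact_mod_cast hL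
    have hCS' : ((#A : ℝ)) ^ 4 ≤ #(A + A) * (A.addEnergy A : ℝ) := by
      have : ((#A ^ 2 * #A ^ 2 : ℕ) : ℝ) ≤ ((#(A + A) * A.addEnergy A : ℕ) : ℝ) := by
        exact_mod_cast hCS
      push_cast at this
      nlinarith [this]
    have hcd' : 2 * (#A : ℝ) - 1 ≤ #(A + A) := by
      have : ((#A + #A - 1 : ℕ) : ℝ) ≤ #(A + A) := by exact_mod_cast hcd
      rw [Nat.cast_sub (by omega)] at this
      push_cast at this
      linarith
    have ha : (101 : ℝ) ≤ #A := by exact_mod_cast h100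
    have hp0 : (0 : ℝ) < p := by exact_mod_cast hp'.pos
    exact LevShkredov.numerics (a := #A) (s := #(A + A)) (e := A.addEnergy A)
      (f := A.addEnergy (A + A)) hp0 ha hcd' h2A.le hAp.le (by linarith [hU]) hL' hCS'

/-! ## Lemma 3: Schur triples in a small set (via Pollard's theorem) -/

namespace LevShkredov

section SchurTriples

variable {p : ℕ} [hp : Fact p.Prime]

open Pollard in
/-- The number of pairs `(x, y) ∈ D²` with `x − y = z` is Pollard's representation number
`r_{D,−D}(z)`. [folklore] -/
private theorem card_filter_sub_eq_rep (D : Finset (ZMod p)) (z : ZMod p) :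
    #((D ×ˢ D).filter (fun q => q.1 - q.2 = z)) = rep D (-D) z := by
  rw [rep_def]
  refine card_bij' (fun q _ => (q.1, -q.2)) (fun q _ => (q.1, -q.2)) ?_ ?_ ?_ ?_
  · intro q hq
    simp only [mem_filter, mem_product] at hq ⊢
    refine ⟨⟨hq.1.1, mem_neg'.2 (by rw [neg_neg]; exact hq.1.2)⟩, ?_⟩
    rw [← hq.2, sub_eq_add_neg]
  · intro q hq
    simp only [mem_filter, mem_product] at hq ⊢
    refine ⟨⟨hq.1.1, mem_neg'.1 hq.1.2⟩, ?_⟩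
    rw [← hq.2, sub_neg_eq_add]
  · intro q hq
    simp
  · intro q hq
    simp

open Pollard in
/-- **Lev–Shkredov 2020, Lemma 3** (a rearrangement bound for Schur triples, there derived from
Lev's theorem [b:l] on linear equations over `𝔽_p`).  "Let `p` be a prime. For any set `D ⊆ 𝔽_p`
with `|D|` odd and `|D| ≤ (2p+1)/3`, we have `Σ_{x,y ∈ D} D(x−y) ≤ (3/4)|D|² + 1/4`."  Here
`Σ_{x,y∈D} D(x−y) = |{(x,y) ∈ D² : x − y ∈ D}|`, and the bound is stated as `4·(…) ≤ 3|D|² + 1`;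
the printed hypothesis "`|D|` odd" is not needed and dropped (for even `|D|` the same argument
gives `≤ (3/4)|D|²`).  DEVIATION (proof): instead of Lev's rearrangement theorem we use POLLARD's
theorem (tree `pollard`, Pollard 1974 / Nathanson Thm 2.4) with `t = ⌈|D|/2⌉`: writing
`r = r_{D,−D}`, `T = Σ_{z∈D} r(z)`, one has `T + Σ_z min(t, r(z)) ≤ |D|t + |D|²` (split the second
sum over `D` and its complement) and Pollard's `Σ_z min(t, r(z)) ≥ t·min(p, 2|D| − t) = t(2|D| − t)`
(`2|D| − t ≤ p` by `3|D| ≤ 2p + 1`), whence `T ≤ |D|² − t(|D| − t) ≤ (3|D|² + 1)/4`.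
[cite: LevShkredov2020, Lemma 3] [cite: Pollard1974, Thm 1 (use)] -/
theorem schur_triples_le (D : Finset (ZMod p)) (h3 : 3 * #D ≤ 2 * p + 1) :
    4 * #((D ×ˢ D).filter (fun q => q.1 - q.2 ∈ D)) ≤ 3 * #D ^ 2 + 1 := by
  classical
  have hp' := hp.out
  set m := #D with hm
  -- `T = Σ_{z ∈ D} r(z)`
  set T := #((D ×ˢ D).filter (fun q => q.1 - q.2 ∈ D)) with hT
  have hTsum : T = ∑ z ∈ D, rep D (-D) z := by
    rw [hT, card_eq_sum_card_fiberwise (f := fun q : ZMod p × ZMod p => q.1 - q.2) (t := D)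
      (fun q hq => by
        rw [mem_coe, mem_filter] at hq
        exact mem_coe.2 hq.2)]
    refine sum_congr rfl fun z hz => ?_
    rw [← card_filter_sub_eq_rep, filter_filter]
    congr 1
    ext q
    simp only [mem_filter, mem_product, and_assoc]
    constructor
    · rintro ⟨h1, h2, _, h4⟩
      exact ⟨h1, h2, h4⟩
    · rintro ⟨h1, h2, h4⟩
      exact ⟨h1, h2, by rw [h4]; exact hz, h4⟩
  have hcard_neg : #(-D) = m := by rw [card_neg]
  -- `Σ_z r(z) = m²`
  have hsumrep : ∑ z, rep D (-D) z = m * m := by rw [sum_rep, hcard_neg]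
  -- the main inequality for any admissible `t`
  have key : ∀ t : ℕ, 1 ≤ t → t ≤ m → m + m - t ≤ p → T + t * (m + m - t) ≤ m * t + m * m := by
    intro t ht1 htm htp
    have hpol := pollard D (-D) ht1 htm (by rw [hcard_neg]; exact htm)
    rw [hcard_neg, min_eq_right htp] at hpol
    have hsplit : ∑ z, min t (rep D (-D) z) ≤
        ∑ z ∈ D, min t (rep D (-D) z) + ∑ z ∈ Dᶜ, rep D (-D) z := by
      rw [← sum_add_sum_compl D]
      exact Nat.add_le_add_left (sum_le_sum fun z _ => min_le_right _ _) _
    have hD1 : ∑ z ∈ D, min t (rep D (-D) z) ≤ m * t := by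
      calc ∑ z ∈ D, min t (rep D (-D) z) ≤ ∑ z ∈ D, t := sum_le_sum fun z _ => min_le_left _ _
        _ = m * t := by rw [sum_const, smul_eq_mul, hm]
    have hD2 : ∑ z ∈ D, rep D (-D) z + ∑ z ∈ Dᶜ, rep D (-D) z = m * m := by
      rw [sum_add_sum_compl, hsumrep]
    rw [hTsum]
    omega
  -- the empty set
  rcases Nat.eq_zero_or_pos m with hm0 | hmpos
  · have : T = 0 := by
      rw [hT, Finset.card_eq_zero, filter_eq_empty_iff]
      intro q hq
      have : D = ∅ := card_eq_zero.1 (by rw [← hm]; exact hm0)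
      rw [this] at hq
      simp at hq
    rw [this]
    omega
  -- parity split: `t = ⌈m/2⌉`
  rcases Nat.even_or_odd m with ⟨n, hn⟩ | ⟨n, hn⟩
  · -- `m = n + n`, `t = n`
    have h := key n (by omega) (by omega) (by omega)
    have e1 : n * (m + m - n) = n * (3 * n) := by rw [hn]; congr 1; omega
    rw [e1, hn] at h
    rw [hn]
    nlinarith [h]
  · -- `m = 2n + 1`, `t = n + 1`
    have h := key (n + 1) (by omega) (by omega) (by omega)
    have e1 : (n + 1) * (m + m - (n + 1)) = (n + 1) * (3 * n + 1) := by rw [hn]; congr 1; omega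
    rw [e1, hn] at h
    rw [hn]
    nlinarith [h]

/-- Lemma 3 for the DIFFERENCE SET `D = A − A` when `2|A − A| < p` (then `3|D| ≤ 2p + 1`):
`4·|{(x,y) ∈ D² : x − y ∈ D}| ≤ 3|D|² + 1` — the form used in the proof of Lemma 4.
[cite: LevShkredov2020, Lemma 3; Lemma 4 (proof)] -/
theorem schur_triples_sub_le (A : Finset (ZMod p)) (hD : 2 * #(A - A) < p) :
    4 * #(((A - A) ×ˢ (A - A)).filter (fun q => q.1 - q.2 ∈ A - A)) ≤ 3 * #(A - A) ^ 2 + 1 :=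
  schur_triples_le (A - A) (by omega)

end SchurTriples

/-! ## Lemma 4: an energy increment for sets with few differences (third moments) -/

section ThirdMoment

variable {p : ℕ} [hp : Fact p.Prime]

/-- `a − b = a' − b' ↔ a − a' = b − b'`. [folklore] -/
private theorem sub_eq_sub_comm' {G : Type*} [AddCommGroup G] {a b a' b' : G} :
    a - b = a' - b' ↔ a - a' = b - b' := by
  rw [sub_eq_sub_iff_add_eq_add, sub_eq_sub_iff_add_eq_add, add_comm a' b]

/-- The sixfold count `|{(a,a′,b,b′,c,c′) ∈ A⁶ : a − a′ = b − b′ = c − c′}|` is the third energy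
`E₃(A) = Σ_{z ∈ A−A} |A ∩ (z + A)|³` ("basic properties of higher energies", [ss]).
[cite: LevShkredov2020, Lemma 4 (proof)] -/
private theorem card_six_eq_sum_cube (A : Finset (ZMod p)) :
    #((((A ×ˢ A) ×ˢ (A ×ˢ A)) ×ˢ (A ×ˢ A)).filter
      (fun τ => τ.1.1.1 - τ.1.1.2 = τ.1.2.1 - τ.1.2.2 ∧ τ.1.1.1 - τ.1.1.2 = τ.2.1 - τ.2.2)) =
      ∑ z ∈ A - A, #(A ∩ (z +ᵥ A)) ^ 3 := by
  classical
  rw [card_eq_sum_card_fiberwise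
    (s := (((A ×ˢ A) ×ˢ (A ×ˢ A)) ×ˢ (A ×ˢ A)).filter
      (fun τ => τ.1.1.1 - τ.1.1.2 = τ.1.2.1 - τ.1.2.2 ∧ τ.1.1.1 - τ.1.1.2 = τ.2.1 - τ.2.2))
    (t := A - A)
    (f := fun τ : ((ZMod p × ZMod p) × (ZMod p × ZMod p)) × (ZMod p × ZMod p) => τ.1.1.1 - τ.1.1.2)
    (fun τ hτ => by
      rw [mem_coe, mem_filter, mem_product, mem_product, mem_product] at hτ
      exact mem_coe.2 (sub_mem_sub hτ.1.1.1.1 hτ.1.1.1.2))]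
  refine sum_congr rfl fun z _ => ?_
  set F : Finset (ZMod p × ZMod p) := (A ×ˢ A).filter (fun u => u.1 - u.2 = z) with hF
  have hFc : #F = #(A ∩ (z +ᵥ A)) := card_filter_sub_eq_card_inter_vadd A A z
  have hset : ((((A ×ˢ A) ×ˢ (A ×ˢ A)) ×ˢ (A ×ˢ A)).filter
      (fun τ => τ.1.1.1 - τ.1.1.2 = τ.1.2.1 - τ.1.2.2 ∧ τ.1.1.1 - τ.1.1.2 = τ.2.1 - τ.2.2)).filter
      (fun τ => τ.1.1.1 - τ.1.1.2 = z) = (F ×ˢ F) ×ˢ F := by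
    ext ⟨⟨u, v⟩, w⟩
    simp only [mem_filter, mem_product, hF]
    constructor
    · rintro ⟨⟨⟨⟨hu, hv⟩, hw⟩, h1, h2⟩, h3⟩
      exact ⟨⟨⟨hu, h3⟩, ⟨hv, by rw [← h1, h3]⟩⟩, ⟨hw, by rw [← h2, h3]⟩⟩
    · rintro ⟨⟨⟨hu, h3⟩, ⟨hv, h4⟩⟩, ⟨hw, h5⟩⟩
      exact ⟨⟨⟨⟨hu, hv⟩, hw⟩, by rw [h3, h4], by rw [h3, h5]⟩, h3⟩
  rw [hset, card_product, card_product, hFc]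
  ring

/-- Pairs of triples `(a,b,c), (a′,b′,c′) ∈ A³` with `(a − b, a − c) = (a′ − b′, a′ − c′)` are the
sextuples of `card_six_eq_sum_cube` (re-bracketed: `a − b = a′ − b′ ↔ a − a′ = b − b′`).
[cite: LevShkredov2020, Lemma 4 (proof)] -/
private theorem card_pairs_eq_card_six (A : Finset (ZMod p)) :
    #((((A ×ˢ A) ×ˢ A) ×ˢ ((A ×ˢ A) ×ˢ A)).filter
      (fun pr => (pr.1.1.1 - pr.1.1.2, pr.1.1.1 - pr.1.2) = (pr.2.1.1 - pr.2.1.2, pr.2.1.1 - pr.2.2))) =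
    #((((A ×ˢ A) ×ˢ (A ×ˢ A)) ×ˢ (A ×ˢ A)).filter
      (fun τ => τ.1.1.1 - τ.1.1.2 = τ.1.2.1 - τ.1.2.2 ∧ τ.1.1.1 - τ.1.1.2 = τ.2.1 - τ.2.2)) := by
  refine card_bij' (fun pr _ => (((pr.1.1.1, pr.2.1.1), (pr.1.1.2, pr.2.1.2)), (pr.1.2, pr.2.2)))
    (fun τ _ => (((τ.1.1.1, τ.1.2.1), τ.2.1), ((τ.1.1.2, τ.1.2.2), τ.2.2))) ?_ ?_ ?_ ?_
  · rintro ⟨⟨⟨a, b⟩, c⟩, ⟨⟨a', b'⟩, c'⟩⟩ h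
    simp only [mem_filter, mem_product] at h ⊢
    obtain ⟨⟨⟨⟨ha, hb⟩, hc⟩, ⟨⟨ha', hb'⟩, hc'⟩⟩, heq⟩ := h
    have h1 : a - b = a' - b' := (Prod.ext_iff.1 heq).1
    have h2 : a - c = a' - c' := (Prod.ext_iff.1 heq).2
    exact ⟨⟨⟨⟨ha, ha'⟩, ⟨hb, hb'⟩⟩, ⟨hc, hc'⟩⟩, sub_eq_sub_comm'.1 h1, sub_eq_sub_comm'.1 h2⟩
  · rintro ⟨⟨⟨a, a'⟩, ⟨b, b'⟩⟩, ⟨c, c'⟩⟩ h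
    simp only [mem_filter, mem_product] at h ⊢
    obtain ⟨⟨⟨⟨ha, ha'⟩, ⟨hb, hb'⟩⟩, ⟨hc, hc'⟩⟩, h1, h2⟩ := h
    exact ⟨⟨⟨⟨ha, hb⟩, hc⟩, ⟨⟨ha', hb'⟩, hc'⟩⟩,
      Prod.ext (sub_eq_sub_comm'.2 h1) (sub_eq_sub_comm'.2 h2)⟩
  · rintro ⟨⟨⟨a, b⟩, c⟩, ⟨⟨a', b'⟩, c'⟩⟩ _
    rfl
  · rintro ⟨⟨⟨a, a'⟩, ⟨b, b'⟩⟩, ⟨c, c'⟩⟩ _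
    rfl

/-- **The Cauchy–Schwarz step of Lemma 4:** `|A|⁶ ≤ |{(x,y) ∈ D² : x − y ∈ D}| · E₃(A)`, `D = A − A`
("the number of non-zero summands … is the number of pairs representable in the form
`(a−b, a−c)`", and such a pair `(x, y)` has `x, y, x − y ∈ D`). [cite: LevShkredov2020, Lemma 4 (proof)] -/
theorem card_pow_six_le (A : Finset (ZMod p)) :
    (#A * #A * #A) ^ 2 ≤ #(((A - A) ×ˢ (A - A)).filter (fun q => q.1 - q.2 ∈ A - A)) *
      ∑ z ∈ A - A, #(A ∩ (z +ᵥ A)) ^ 3 := by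
  classical
  set S3 : Finset ((ZMod p × ZMod p) × ZMod p) := (A ×ˢ A) ×ˢ A with hS3
  set φ : (ZMod p × ZMod p) × ZMod p → ZMod p × ZMod p :=
    fun τ => (τ.1.1 - τ.1.2, τ.1.1 - τ.2) with hφ
  set W := S3.image φ with hW
  set fib : ZMod p × ZMod p → ℕ := fun q => #(S3.filter (fun τ => φ τ = q)) with hfib
  -- `Σ_{q ∈ W} fib q = |A|³`
  have hsum : ∑ q ∈ W, fib q = #A * #A * #A := by
    have h := card_eq_sum_card_fiberwise (s := S3) (t := W) (f := φ)
      (fun τ hτ => mem_coe.2 (mem_image_of_mem φ (mem_coe.1 hτ)))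
    rw [hS3, card_product, card_product] at h
    rw [← hS3] at h
    simp only [hfib]
    exact h.symm
  -- `Σ_{q ∈ W} (fib q)² = #pairs of triples with the same image = E₃`
  have hsq : ∑ q ∈ W, fib q ^ 2 =
      #((S3 ×ˢ S3).filter (fun pr => φ pr.1 = φ pr.2)) := by
    rw [card_eq_sum_card_fiberwise (s := (S3 ×ˢ S3).filter (fun pr => φ pr.1 = φ pr.2)) (t := W)
      (f := fun pr => φ pr.1)
      (fun pr hpr => by
        rw [mem_coe, mem_filter, mem_product] at hpr
        exact mem_coe.2 (mem_image_of_mem φ hpr.1.1))]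
    refine sum_congr rfl fun q _ => ?_
    have hset : ((S3 ×ˢ S3).filter (fun pr => φ pr.1 = φ pr.2)).filter (fun pr => φ pr.1 = q) =
        (S3.filter (fun τ => φ τ = q)) ×ˢ (S3.filter (fun τ => φ τ = q)) := by
      ext ⟨τ, τ'⟩
      simp only [mem_filter, mem_product]
      constructor
      · rintro ⟨⟨⟨h1, h2⟩, h3⟩, h4⟩
        exact ⟨⟨h1, h4⟩, ⟨h2, by rw [← h3, h4]⟩⟩
      · rintro ⟨⟨h1, h4⟩, ⟨h2, h5⟩⟩
        exact ⟨⟨⟨h1, h2⟩, by rw [h4, h5]⟩, h4⟩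
    rw [hset, card_product, hfib, sq]
  have hpairs : #((S3 ×ˢ S3).filter (fun pr => φ pr.1 = φ pr.2)) =
      ∑ z ∈ A - A, #(A ∩ (z +ᵥ A)) ^ 3 := by
    rw [← card_six_eq_sum_cube, ← card_pairs_eq_card_six]
  -- `W ⊆ {(x,y) ∈ D² : x − y ∈ D}`
  have hWsub : W ⊆ ((A - A) ×ˢ (A - A)).filter (fun q => q.1 - q.2 ∈ A - A) := by
    intro q hq
    obtain ⟨τ, hτ, rfl⟩ := mem_image.1 hq
    rw [hS3, mem_product, mem_product] at hτ
    simp only [hφ, mem_filter, mem_product]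
    refine ⟨⟨sub_mem_sub hτ.1.1 hτ.1.2, sub_mem_sub hτ.1.1 hτ.2⟩, ?_⟩
    have : τ.1.1 - τ.1.2 - (τ.1.1 - τ.2) = τ.2 - τ.1.2 := by ring
    rw [this]
    exact sub_mem_sub hτ.2 hτ.1.2
  -- Cauchy–Schwarz
  have hcs := sum_mul_sq_le_sq_mul_sq W (fun q => fib q) (fun _ => 1)
  simp only [mul_one, one_pow, sum_const, smul_eq_mul] at hcs
  rw [hsum, hsq, hpairs] at hcs
  calc (#A * #A * #A) ^ 2
      ≤ (∑ z ∈ A - A, #(A ∩ (z +ᵥ A)) ^ 3) * #W := hcs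
    _ ≤ (∑ z ∈ A - A, #(A ∩ (z +ᵥ A)) ^ 3) *
        #(((A - A) ×ˢ (A - A)).filter (fun q => q.1 - q.2 ∈ A - A)) :=
        Nat.mul_le_mul_left _ (card_le_card hWsub)
    _ = _ := mul_comm _ _

/-- **Lev–Shkredov 2020, Lemma 4** (energy of sets with few differences), cleared of
denominators.  "Let `p` be a prime, and suppose that a subset `A ⊂ 𝔽_p` satisfies
`|A−A| = K|A| < p/2`.  Then `E(A) ≥ (1/K + (1 − |A|⁻²)/(3K(K+2))) |A|³`."  With `a = |A|`,
`d = |A − A|` this reads `E(A) ≥ a⁴/d + (a⁵ − a³)/(3(d + 2a)d)`, i.e.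
`3(d + 2a)a⁴ + a⁵ ≤ 3d(d + 2a)E(A) + a³`.  Proof as printed: with `r(x) = |A_x|`,
`λ = a²/d`, `F = r − λ` on `D`: `σ₁ = 0`, `σ₂ = E − a⁴/d`, `F ≤ a − λ` give
`E₃ = Σ_D r³ ≤ (1 + 2a/d)(E − a⁴/d)a + a⁶/d²` (here: termwise `(dr − a²)²(a − r) ≥ 0`, summed);
`a⁶ ≤ E₃ · |{(x,y) ∈ D² : x − y ∈ D}|` (`card_pow_six_le`) and Lemma 3 give
`E₃(3d² + 1) ≥ 4a⁶`, and `E₃ ≤ a⁴`; "a short computation" gives the claim.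
[cite: LevShkredov2020, Lemma 4] -/
theorem addEnergy_lower_of_few_differences {A : Finset (ZMod p)} (hA : A.Nonempty)
    (hD : 2 * #(A - A) < p) :
    3 * ((#(A - A) : ℝ) + 2 * #A) * (#A : ℝ) ^ 4 + (#A : ℝ) ^ 5 ≤
      3 * #(A - A) * ((#(A - A) : ℝ) + 2 * #A) * (A.addEnergy A : ℝ) + (#A : ℝ) ^ 3 := by
  classical
  have hp' := hp.out
  set D := A - A with hDdef
  set r : ZMod p → ℕ := fun z => #(A ∩ (z +ᵥ A)) with hr
  -- the basic sums
  have hsum1 : ∑ z ∈ D, r z = #A * #A := sum_card_inter_vadd_eq A A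
  have hsum2 : A.addEnergy A = ∑ z ∈ D, r z * r z := by
    rw [addEnergy_eq_sum_inter_mul_inter, ← hDdef, inter_self]
  have hrle : ∀ z, r z ≤ #A := fun z => card_le_card inter_subset_left
  set E3 := ∑ z ∈ D, r z ^ 3 with hE3
  -- `E₃ ≤ a⁴`, `E ≤ a³`
  have hEle : A.addEnergy A ≤ #A * (#A * #A) := by
    rw [hsum2, ← hsum1, mul_sum]
    exact sum_le_sum fun z _ => Nat.mul_le_mul_right _ (hrle z)
  have hE3le : E3 ≤ #A * A.addEnergy A := by
    rw [hE3, hsum2, mul_sum]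
    refine sum_le_sum fun z _ => ?_
    rw [pow_succ, pow_two, mul_comm]
    exact Nat.mul_le_mul_right _ (hrle z)
  -- lower bound `4a⁶ ≤ (3d²+1) E₃`
  have hlow : 4 * (#A * #A * #A) ^ 2 ≤ (3 * #D ^ 2 + 1) * E3 := by
    have h1 := card_pow_six_le A
    have h2 := schur_triples_sub_le A hD
    rw [← hDdef] at h1 h2
    calc 4 * (#A * #A * #A) ^ 2
        ≤ 4 * (#((D ×ˢ D).filter (fun q => q.1 - q.2 ∈ D)) * E3) := Nat.mul_le_mul_left 4 h1
      _ = (4 * #((D ×ˢ D).filter (fun q => q.1 - q.2 ∈ D))) * E3 := by ring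
      _ ≤ (3 * #D ^ 2 + 1) * E3 := Nat.mul_le_mul_right _ h2
  -- upper bound `d² E₃ ≤ (a d² + 2a² d) E − a⁵ d − a⁶` (reals), from `(d r − a²)² (a − r) ≥ 0`
  have hup : ((#D : ℝ)) ^ 2 * (E3 : ℝ) ≤
      ((#A : ℝ) * #D ^ 2 + 2 * (#A : ℝ) ^ 2 * #D) * (A.addEnergy A : ℝ) -
        (#A : ℝ) ^ 5 * #D - (#A : ℝ) ^ 6 := by
    have hterm : ∀ z ∈ D, ((#D : ℝ)) ^ 2 * ((r z : ℝ)) ^ 3 ≤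
        ((#A : ℝ) * #D ^ 2 + 2 * (#A : ℝ) ^ 2 * #D) * ((r z : ℝ) * r z) -
          (2 * (#A : ℝ) ^ 3 * #D + (#A : ℝ) ^ 4) * r z + (#A : ℝ) ^ 5 := by
      intro z _
      have h1 : ((r z : ℝ)) ≤ #A := by exact_mod_cast hrle z
      have h2 := mul_nonneg (sq_nonneg ((#D : ℝ) * r z - (#A : ℝ) ^ 2)) (sub_nonneg.2 h1)
      nlinarith [h2]
    have hs := sum_le_sum hterm
    rw [← mul_sum, sum_add_distrib, sum_sub_distrib, ← mul_sum, ← mul_sum, sum_const,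
      nsmul_eq_mul] at hs
    have e1 : (∑ z ∈ D, ((r z : ℝ)) ^ 3) = (E3 : ℝ) := by rw [hE3]; push_cast; rfl
    have e2 : (∑ z ∈ D, ((r z : ℝ)) * r z) = (A.addEnergy A : ℝ) := by
      rw [hsum2]; push_cast; rfl
    have e3 : (∑ z ∈ D, ((r z : ℝ))) = (#A : ℝ) * #A := by
      have : ((∑ z ∈ D, r z : ℕ) : ℝ) = ((#A * #A : ℕ) : ℝ) := by rw [hsum1]
      push_cast at this
      exact this
    rw [e1, e2, e3] at hs
    nlinarith [hs]
  -- combine (all in `ℝ`)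
  have ha0 : (0 : ℝ) < #A := by exact_mod_cast card_pos.2 hA
  have hlow' : 4 * ((#A : ℝ) * #A * #A) ^ 2 ≤ (3 * (#D : ℝ) ^ 2 + 1) * (E3 : ℝ) := by
    exact_mod_cast hlow
  have hE3le' : (E3 : ℝ) ≤ #A * (A.addEnergy A : ℝ) := by exact_mod_cast hE3le
  have hEle' : (A.addEnergy A : ℝ) ≤ #A * (#A * #A) := by exact_mod_cast hEle
  -- `a · (goal)` then cancel `a`
  have key : (#A : ℝ) * (3 * ((#D : ℝ) + 2 * #A) * (#A : ℝ) ^ 4 + (#A : ℝ) ^ 5) ≤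
      (#A : ℝ) * (3 * #D * ((#D : ℝ) + 2 * #A) * (A.addEnergy A : ℝ) + (#A : ℝ) ^ 3) := by
    nlinarith [hlow', hup, hE3le', hEle', ha0]
  exact le_of_mul_le_mul_left key ha0

/-- Lemma 4 in the printed shape: with `K = |A − A|/|A|`,
`E(A) ≥ (1/K + (1 − |A|⁻²)/(3K(K+2))) |A|³`. [cite: LevShkredov2020, Lemma 4] -/
theorem addEnergy_lower_of_few_differences' {A : Finset (ZMod p)} (hA : A.Nonempty)
    (hD : 2 * #(A - A) < p) :
    (1 / ((#(A - A) : ℝ) / #A) +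
        (1 - 1 / (#A : ℝ) ^ 2) / (3 * ((#(A - A) : ℝ) / #A) * ((#(A - A) : ℝ) / #A + 2))) *
      (#A : ℝ) ^ 3 ≤ (A.addEnergy A : ℝ) := by
  have h := addEnergy_lower_of_few_differences hA hD
  have ha0 : (0 : ℝ) < #A := by exact_mod_cast card_pos.2 hA
  have hd0 : (0 : ℝ) < #(A - A) := by
    obtain ⟨a, ha⟩ := hA
    exact_mod_cast card_pos.2 ⟨a - a, sub_mem_sub ha ha⟩
  have e : (1 / ((#(A - A) : ℝ) / #A) +
        (1 - 1 / (#A : ℝ) ^ 2) / (3 * ((#(A - A) : ℝ) / #A) * ((#(A - A) : ℝ) / #A + 2))) *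
      (#A : ℝ) ^ 3 =
      (3 * ((#(A - A) : ℝ) + 2 * #A) * (#A : ℝ) ^ 4 + (#A : ℝ) ^ 5 - (#A : ℝ) ^ 3) /
        (3 * #(A - A) * ((#(A - A) : ℝ) + 2 * #A)) := by
    field_simp
    ring
  rw [e, div_le_iff₀ (by positivity)]
  linarith

end ThirdMoment

/-! ## Theorem 3: the difference-set chain and its numerics -/

section Differences

variable {p : ℕ} [hp : Fact p.Prime]

/-- `|X ∩ (−z + X)| = |X ∩ (z + X)|`. [folklore] -/
private theorem card_inter_neg_vadd (X : Finset (ZMod p)) (z : ZMod p) :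
    #(X ∩ (-z +ᵥ X)) = #(X ∩ (z +ᵥ X)) := by
  have : X ∩ (-z +ᵥ X) = -z +ᵥ ((z +ᵥ X) ∩ X) := by
    rw [vadd_finset_inter, neg_vadd_vadd]
  rw [this, card_vadd_finset, inter_comm]

/-- The Katz–Koester inclusion of the printed proof, `|A − A_x| ≤ |D_x|`: `A − A_z ⊆ D ∩ (−z + D)`
with `A_z = A ∩ (z + A)`, `D = A − A`. [cite: LevShkredov2020, Thm 3 (proof)] -/
theorem sub_inter_vadd_subset (A : Finset (ZMod p)) (z : ZMod p) :
    A - A ∩ (z +ᵥ A) ⊆ (A - A) ∩ (-z +ᵥ (A - A)) := by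
  intro x hx
  obtain ⟨a, ha, b, hb, rfl⟩ := mem_sub.1 hx
  obtain ⟨hbA, hbz⟩ := mem_inter.1 hb
  obtain ⟨c, hc, hcb⟩ := mem_vadd_finset.1 hbz
  refine mem_inter.2 ⟨sub_mem_sub ha hbA, mem_vadd_finset.2 ⟨a - c, sub_mem_sub ha hc, ?_⟩⟩
  rw [← hcb, vadd_eq_add, vadd_eq_add]
  ring

/-- **The lower bound of Lev–Shkredov's chain for DIFFERENCES** (proof of Theorem 3, with the
bookkeeping CORRECTED): for non-empty `A ⊆ 𝔽_p` with `2|A| ≤ p`, `D = A − A`,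
`Σ_x |A_x||D_x| = E(A,D) ≥ |A||D| + Σ_{x ∈ D∖0} |A_x|(|A| + |A_x| − 1) = |A|³ + E(A) + |A||D| − 3|A|² + |A|`.
PRINT NIT: the paper's display (p. 6 of arXiv:1912.03483) evaluates `Σ_{x∈D∖0} |A_x|` as `|D| − 1`
instead of `|A|² − |A|` and so states the (unjustified) bound `> |A|³ + E(A) + (K−2)|A|² − K|A|`;
the correct value is as here (and as in their own proof of Theorem 4).  Ingredients: tree
`addEnergy_eq_sum_inter_mul_inter` (`(A−A) ∩ (D−D) = D`), `sub_inter_vadd_subset` +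
`card_inter_neg_vadd` (`|D_x| ≥ |A − A_x|`), Cauchy–Davenport for `A + (−A_x)`.
[cite: LevShkredov2020, Thm 3 (proof)] -/
theorem addEnergy_sub_lower {A : Finset (ZMod p)} (hA : A.Nonempty) (h2 : 2 * #A ≤ p) :
    #A ^ 3 + A.addEnergy A + #A + #A * #(A - A) ≤ A.addEnergy (A - A) + 3 * #A ^ 2 := by
  classical
  have hp' := hp.out
  set D := A - A with hD
  obtain ⟨a₀, ha₀⟩ := hA
  have h0D : (0 : ZMod p) ∈ D := by
    rw [hD, ← sub_self a₀]
    exact sub_mem_sub ha₀ ha₀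
  have hDD : D ∩ (D - D) = D := by
    refine inter_eq_left.2 fun z hz => ?_
    have : z = z - 0 := (sub_zero z).symm
    rw [this]
    exact sub_mem_sub hz h0D
  have hE : A.addEnergy D = ∑ z ∈ D, #(A ∩ (z +ᵥ A)) * #(D ∩ (z +ᵥ D)) := by
    rw [addEnergy_eq_sum_inter_mul_inter, hDD]
  have hEA : A.addEnergy A = ∑ z ∈ D, #(A ∩ (z +ᵥ A)) * #(A ∩ (z +ᵥ A)) := by
    rw [addEnergy_eq_sum_inter_mul_inter, inter_self]
  have hsum : ∑ z ∈ D, #(A ∩ (z +ᵥ A)) = #A * #A := sum_card_inter_vadd_eq A A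
  have hA0 : A ∩ ((0 : ZMod p) +ᵥ A) = A := by rw [zero_vadd, inter_self]
  have hD0 : D ∩ ((0 : ZMod p) +ᵥ D) = D := by rw [zero_vadd, inter_self]
  -- termwise Cauchy–Davenport for `z ≠ 0`
  have hterm : ∀ z ∈ D.erase 0,
      #(A ∩ (z +ᵥ A)) * (#A + #(A ∩ (z +ᵥ A))) ≤
        #(A ∩ (z +ᵥ A)) * #(D ∩ (z +ᵥ D)) + #(A ∩ (z +ᵥ A)) := by
    intro z hz
    have hzD : z ∈ D := mem_of_mem_erase hz
    obtain ⟨a, ha, a', ha', haz⟩ := mem_sub.1 hzD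
    have hAz : (A ∩ (z +ᵥ A)).Nonempty := by
      refine ⟨a, mem_inter.2 ⟨ha, mem_vadd_finset.2 ⟨a', ha', ?_⟩⟩⟩
      rw [← haz, vadd_eq_add, sub_add_cancel]
    have hle : #(A ∩ (z +ᵥ A)) ≤ #A := card_le_card inter_subset_left
    have hneg : (-(A ∩ (z +ᵥ A))).Nonempty := hAz.neg
    have hcardneg : #(-(A ∩ (z +ᵥ A))) = #(A ∩ (z +ᵥ A)) := card_neg _
    have hcd := ZMod.cauchy_davenport hp' ⟨a, ha⟩ hneg
    rw [hcardneg, min_eq_right (by omega : #A + #(A ∩ (z +ᵥ A)) - 1 ≤ p)] at hcd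
    have hsub : #(A + -(A ∩ (z +ᵥ A))) ≤ #(D ∩ (z +ᵥ D)) := by
      rw [← sub_eq_add_neg, ← card_inter_neg_vadd D z]
      exact card_le_card (sub_inter_vadd_subset A z)
    have h1 : #A + #(A ∩ (z +ᵥ A)) ≤ #(D ∩ (z +ᵥ D)) + 1 := by omega
    calc #(A ∩ (z +ᵥ A)) * (#A + #(A ∩ (z +ᵥ A)))
        ≤ #(A ∩ (z +ᵥ A)) * (#(D ∩ (z +ᵥ D)) + 1) := Nat.mul_le_mul_left _ h1
      _ = #(A ∩ (z +ᵥ A)) * #(D ∩ (z +ᵥ D)) + #(A ∩ (z +ᵥ A)) := by ring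
  have hXY : ∑ z ∈ D.erase 0, #(A ∩ (z +ᵥ A)) * (#A + #(A ∩ (z +ᵥ A))) ≤
      ∑ z ∈ D.erase 0, #(A ∩ (z +ᵥ A)) * #(D ∩ (z +ᵥ D)) +
        ∑ z ∈ D.erase 0, #(A ∩ (z +ᵥ A)) := by
    rw [← sum_add_distrib]
    exact sum_le_sum hterm
  have e1 := sum_erase_add D (fun z => #(A ∩ (z +ᵥ A)) * #(D ∩ (z +ᵥ D))) h0D
  have e2 := sum_erase_add D (fun z => #(A ∩ (z +ᵥ A))) h0D
  have e3 := sum_erase_add D (fun z => #(A ∩ (z +ᵥ A)) * (#A + #(A ∩ (z +ᵥ A)))) h0D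
  simp only [hA0, hD0] at e1 e2 e3
  have e4 : ∑ z ∈ D, #(A ∩ (z +ᵥ A)) * (#A + #(A ∩ (z +ᵥ A))) =
      #A * (#A * #A) + A.addEnergy A := by
    rw [hEA, ← hsum, mul_sum, ← sum_add_distrib]
    refine sum_congr rfl fun z _ => ?_
    ring
  rw [hE]
  linarith [hXY, e1, e2, e3, e4, hsum]

/-- The quartic of the closing step: `N(a) < 0` for `a ≥ 5` (`N(5 + t)` has negative
coefficients). [cite: LevShkredov2020, Thm 3 (proof)] -/
private theorem quartic_neg {a : ℝ} (ha : 5 ≤ a) :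
    (340659 / 6250 - 2569518 / 15625 * a + 12913277 / 78125 * a ^ 2
      - 24380693 / 390625 * a ^ 3 - 85373 / 11718750 * a ^ 4 : ℝ) < 0 := by
  obtain ⟨t, ht, rfl⟩ : ∃ t : ℝ, 0 ≤ t ∧ a = t + 5 := ⟨a - 5, by linarith, by ring⟩
  have h2 := pow_nonneg ht 2
  have h3 := pow_nonneg ht 3
  have h4 := pow_nonneg ht 4
  linarith

set_option maxHeartbeats 800000 in
/-- The final computation of the proof of Theorem 3 (CORRECTED bookkeeping, see
`addEnergy_sub_lower`), in exact arithmetic.  With `a = |A| ≥ 5`, `d = |A − A| ∈ [2a − 1, 2.6a − 3]`,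
`e = E(A)`, `f = E(A, A − A)`, `η₀ = (2/3)·2.6 − 1 = 11/15`, `a ≤ 0.0045p`: the Fourier bound
`p f ≤ a²d² + η₀²a²(dp − d²)`, the Cauchy–Davenport bound `a³ + e + a + ad ≤ f + 3a²` and
Lemma 4 `3(d+2a)a⁴ + a⁵ ≤ 3d(d+2a)e + a³` are contradictory.  Route: with `K = d/a`,
`α = a/p ≤ 0.0045`, they force `g(K) ≥ 0` for
`g(K) = (1−η₀²)·0.0045·K² + (η₀² − 1/a)K + 3/a − 1/a² − 1 − 1/K − (1 − 1/a²)/(3K(K+2))`, which is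
increasing in `K` (the printed monotonicity step); but at `K = 2.6 − 3/a` (the sharper upper end
that the hypothesis `|A−A| < 2.6|A| − 3` provides — the printed argument substitutes `K → 2.6`,
which no longer suffices once the bookkeeping is corrected) `g < 0` for every real `a ≥ 5`
(`a²·3(2.6a−3)(4.6a−3)·g = N(a)`, a quartic with `N(5 + t)` having all coefficients negative).
[cite: LevShkredov2020, Thm 3 (proof)] -/
theorem numerics_sub {a d e f p : ℝ} (hp : 0 < p) (ha : 5 ≤ a) (hd1 : 2 * a - 1 ≤ d)
    (hd2 : d ≤ 2.6 * a - 3) (hap : a ≤ 0.0045 * p)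
    (h1 : p * f ≤ a ^ 2 * d ^ 2 + (11 / 15) ^ 2 * a ^ 2 * (d * p - d ^ 2))
    (h2 : a ^ 3 + e + a + a * d ≤ f + 3 * a ^ 2)
    (h3 : 3 * (d + 2 * a) * a ^ 4 + a ^ 5 ≤ 3 * d * (d + 2 * a) * e + a ^ 3) : False := by
  have ha0 : 0 < a := by linarith
  have hd0 : 0 < d := by linarith
  have hda : 0 < d + 2 * a := by linarith
  -- the quantity `M`
  set M : ℝ := 3 * d * (d + 2 * a) * (a ^ 3 + a + a * d - 3 * a ^ 2) + 3 * (d + 2 * a) * a ^ 4 +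
    a ^ 5 - a ^ 3 - 3 * (11 / 15) ^ 2 * a ^ 2 * d ^ 2 * (d + 2 * a) with hM
  -- Step 1: `p M ≤ 3 (1 − η₀²) a² d³ (d + 2a)`
  have hB : p * M ≤ 3 * (1 - (11 / 15) ^ 2) * a ^ 2 * d ^ 3 * (d + 2 * a) := by
    have e1 : p * (a ^ 3 + e + a + a * d - 3 * a ^ 2) ≤
        a ^ 2 * d ^ 2 + (11 / 15) ^ 2 * a ^ 2 * (d * p - d ^ 2) := by
      have := mul_le_mul_of_nonneg_left h2 hp.le
      linarith
    have e2 : p * (3 * (d + 2 * a) * a ^ 4 + a ^ 5) ≤ p * (3 * d * (d + 2 * a) * e + a ^ 3) :=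
      mul_le_mul_of_nonneg_left h3 hp.le
    have e3 := mul_le_mul_of_nonneg_left e1 (by positivity : (0 : ℝ) ≤ 3 * d * (d + 2 * a))
    rw [hM]
    linarith [e2, e3]
  -- Step 2: `M ≤ 0.0045 · 3 (1 − η₀²) a d³ (d + 2a)`
  have hpos : (0 : ℝ) < 1 - (11 / 15) ^ 2 := by norm_num
  have hC : M ≤ 0.0045 * (3 * (1 - (11 / 15) ^ 2) * a * d ^ 3 * (d + 2 * a)) := by
    have hrhs : 0 ≤ 0.0045 * (3 * (1 - (11 / 15) ^ 2) * a * d ^ 3 * (d + 2 * a)) := by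
      have := hpos.le
      positivity
    by_cases hM0 : 0 ≤ M
    · have t1 : a * M ≤ 0.0045 * p * M := mul_le_mul_of_nonneg_right hap hM0
      have t2 : a * M ≤ a * (0.0045 * (3 * (1 - (11 / 15) ^ 2) * a * d ^ 3 * (d + 2 * a))) := by
        linarith [t1, hB]
      exact le_of_mul_le_mul_left t2 ha0
    · push Not at hM0
      linarith
  -- Step 3: in terms of `K = d/a` the last inequality says `g(K) ≥ 0`
  set K : ℝ := d / a with hK
  have hKd : K * a = d := by rw [hK, div_mul_cancel₀ d ha0.ne']
  have hK0 : 0 < K := by positivity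
  have hKlo : 1.8 ≤ K := by
    rw [hK, le_div_iff₀ ha0]
    linarith
  have hKhi : K ≤ 2.6 - 3 / a := by
    rw [hK, div_le_iff₀ ha0, sub_mul, div_mul_cancel₀ _ ha0.ne']
    linarith
  set g : ℝ → ℝ := fun k => (1 - (11 / 15 : ℝ) ^ 2) * 0.0045 * k ^ 2 + ((11 / 15) ^ 2 - 1 / a) * k +
    3 / a - 1 / a ^ 2 - 1 - 1 / k - (1 - 1 / a ^ 2) / (3 * k * (k + 2)) with hg
  have hid : 0.0045 * (3 * (1 - (11 / 15) ^ 2) * a * d ^ 3 * (d + 2 * a)) - M =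
      a ^ 5 * (3 * K * (K + 2)) * g K := by
    rw [hM, hg, ← hKd]
    field_simp
    ring
  have hgK : 0 ≤ g K := by
    have h' : 0 ≤ a ^ 5 * (3 * K * (K + 2)) * g K := by rw [← hid]; linarith
    have hposc : 0 < a ^ 5 * (3 * K * (K + 2)) := by positivity
    by_contra hneg
    push Not at hneg
    have := mul_neg_of_pos_of_neg hposc hneg
    linarith
  -- Step 4: `g` is increasing on `[K, Kmax]` (termwise), `Kmax = 2.6 − 3/a`
  set Km : ℝ := 2.6 - 3 / a with hKm
  have h3a : 3 / a ≤ 3 / 5 := div_le_div_of_nonneg_left (by norm_num) (by norm_num) ha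
  have hKm0 : 0 < Km := by rw [hKm]; linarith
  have hmono : g K ≤ g Km := by
    have ha2 : (1 : ℝ) / a ≤ (11 / 15) ^ 2 := by
      have : (1 : ℝ) / a ≤ 1 / 5 := one_div_le_one_div_of_le (by norm_num) ha
      linarith [this, (by norm_num : (1 : ℝ) / 5 ≤ (11 / 15) ^ 2)]
    have hia : 0 ≤ 1 - 1 / a ^ 2 := by
      rw [sub_nonneg]
      exact div_le_one_of_le₀ (by nlinarith) (by positivity)
    have t1 : K ^ 2 ≤ Km ^ 2 := pow_le_pow_left₀ hK0.le hKhi 2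
    have t2 : ((11 / 15 : ℝ) ^ 2 - 1 / a) * K ≤ ((11 / 15) ^ 2 - 1 / a) * Km :=
      mul_le_mul_of_nonneg_left hKhi (by linarith)
    have t3 : 1 / Km ≤ 1 / K := one_div_le_one_div_of_le hK0 hKhi
    have t4 : (1 - 1 / a ^ 2) / (3 * Km * (Km + 2)) ≤ (1 - 1 / a ^ 2) / (3 * K * (K + 2)) := by
      apply div_le_div_of_nonneg_left hia (by positivity)
      linarith [t1, hKhi]
    have t1' := mul_le_mul_of_nonneg_left t1 (by positivity : (0:ℝ) ≤ (1 - (11 / 15 : ℝ) ^ 2) * 0.0045)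
    simp only [hg]
    linarith
  -- Step 5: `g(Kmax) < 0` — a one-variable quartic
  have hneg : g Km < 0 := by
    have hL : 0 < 2.6 * a - 3 := by linarith
    have hM' : 0 < 4.6 * a - 3 := by linarith
    have hden : 0 < a ^ 2 * (3 * (2.6 * a - 3) * (4.6 * a - 3)) := by positivity
    have hval : g Km * (a ^ 2 * (3 * (2.6 * a - 3) * (4.6 * a - 3))) =
        340659 / 6250 - 2569518 / 15625 * a + 12913277 / 78125 * a ^ 2
          - 24380693 / 390625 * a ^ 3 - 85373 / 11718750 * a ^ 4 := by
      rw [hg, hKm]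
      field_simp
      ring
    have hN := quartic_neg ha
    by_contra hcon
    push Not at hcon
    have := mul_nonneg hcon hden.le
    linarith
  linarith

end Differences

end LevShkredov

/-! ## Lemma 2 and Corollary 1 for DIFFERENCE sets -/

namespace FreimanVosper

section RectificationSub

variable {p : ℕ} [hp : Fact p.Prime]

/-- Two integers at distance `< p` that agree modulo `p` are equal. [folklore] -/
private theorem int_eq_of_zmodCast_eq_of_lt {x y : ℤ} (h1 : x - y < p) (h2 : y - x < p)
    (h : (x : ZMod p) = y) : x = y := by
  rw [ZMod.intCast_eq_intCast_iff_dvd_sub] at h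
  obtain ⟨q, hq⟩ := h
  have hp0 : (0 : ℤ) < p := by exact_mod_cast hp.out.pos
  rcases lt_trichotomy q 0 with hq0 | hq0 | hq0
  · have hq1 : q ≤ -1 := by omega
    nlinarith
  · rw [hq0, mul_zero, sub_eq_zero] at hq
    exact hq.symm
  · have hq1 : 1 ≤ q := by omega
    nlinarith

/-- **No wrap-around for differences**: if `B ⊂ [0, p/2)` is a set of integers and `v ≢ 0`, the
affine image `{u + v·n : n ∈ B} ⊆ ℤ/pℤ` has a difference set of the same size as `B − B`.
[cite: LevShkredov2020, Lemma 2 (proof, difference version)] -/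
theorem card_image_affine_sub (B : Finset ℤ) (u v : ZMod p) (hv : v ≠ 0)
    (hB : ∀ n ∈ B, 0 ≤ n ∧ 2 * n < p) :
    #(B.image (fun n : ℤ => u + v * (n : ZMod p)) - B.image (fun n : ℤ => u + v * (n : ZMod p))) =
      #(B - B) := by
  classical
  have himg : B.image (fun n : ℤ => u + v * (n : ZMod p)) - B.image (fun n : ℤ => u + v * (n : ZMod p)) =
      (B - B).image (fun n : ℤ => v * (n : ZMod p)) := by
    ext x
    simp only [mem_sub, mem_image]
    constructor
    · rintro ⟨_, ⟨b₁, hb₁, rfl⟩, _, ⟨b₂, hb₂, rfl⟩, rfl⟩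
      exact ⟨b₁ - b₂, ⟨b₁, hb₁, b₂, hb₂, rfl⟩, by push_cast; ring⟩
    · rintro ⟨_, ⟨b₁, hb₁, b₂, hb₂, rfl⟩, rfl⟩
      exact ⟨_, ⟨b₁, hb₁, rfl⟩, _, ⟨b₂, hb₂, rfl⟩, by push_cast; ring⟩
  rw [himg]
  apply card_image_of_injOn
  intro x hx y hy hxy
  obtain ⟨b₁, hb₁, b₂, hb₂, rfl⟩ := mem_sub.1 (mem_coe.1 hx)
  obtain ⟨c₁, hc₁, c₂, hc₂, rfl⟩ := mem_sub.1 (mem_coe.1 hy)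
  simp only at hxy
  have h1 := mul_left_cancel₀ hv hxy
  obtain ⟨h1a, h1b⟩ := hB b₁ hb₁
  obtain ⟨h2a, h2b⟩ := hB b₂ hb₂
  obtain ⟨h3a, h3b⟩ := hB c₁ hc₁
  obtain ⟨h4a, h4b⟩ := hB c₂ hc₂
  exact int_eq_of_zmodCast_eq_of_lt (p := p) (by linarith) (by linarith) (by exact_mod_cast h1)

end RectificationSub

end FreimanVosper

open FreimanVosper in
/-- **Freiman's rectification lemma for differences** (Lev–Shkredov 2020, Lemma 2, second half:
"An essentially identical statement holds true for the subsets `A ⊆ 𝔽_p` with the difference set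
satisfying `|A−A| < K|A|−3`").  If `|A| < p/12`, `|A − A| < K|A| − 3`, and a progression with
`(p+1)/2` terms contains at least `K|A|/3` elements of `A`, then `A` lies in a progression with at
most `|A − A| − |A| + 1` terms.  Proof: as `freiman_rectification`, with Freiman's `3k−4` theorem
for `A + B`, `|A| = |B|` (tree `freiman_3k4_add`, Nathanson Thm 4.8 / Lev–Smeliansky) applied to
`(S', −S')`, and the exclusion window `4k' − 7 ≤ t ≤ p − 2k' + 3` now coming from
`(A' − A') ∪ (a* − A') ⊆ A − A`. [cite: LevShkredov2020, Lemma 2] -/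
theorem freiman_rectification_sub {p : ℕ} [hp : Fact p.Prime] {A : Finset (ZMod p)} {K : ℝ}
    (h12 : 12 * #A < p) (h2A : (#(A - A) : ℝ) < K * #A - 3)
    {u v : ZMod p} (hv : v ≠ 0) (hAP : K * #A ≤ 3 * (#(A ∩ apFinset u v ((p + 1) / 2)) : ℝ)) :
    ∃ a d : ZMod p, d ≠ 0 ∧ A ⊆ apFinset a d (#(A - A) - #A + 1) := by
  classical
  have hp' := hp.out
  have hp0 : (0 : ℝ) < p := by exact_mod_cast hp'.pos
  set A' : Finset (ZMod p) := A ∩ apFinset u v ((p + 1) / 2) with hA'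
  have hA'sub : A' ⊆ A := inter_subset_left
  have hk'k : #A' ≤ #A := card_le_card hA'sub
  have hAne : A.Nonempty := by
    rw [← card_pos]
    by_contra h0
    push Not at h0
    have : #A = 0 := by omega
    have h1 : (#(A - A) : ℝ) < K * #A - 3 := h2A
    rw [this] at h1
    simp at h1
    have : (0 : ℝ) ≤ #(A - A) := by positivity
    linarith
  have hcd0 := ZMod.cauchy_davenport hp' hAne hAne.neg
  rw [card_neg, ← sub_eq_add_neg, min_eq_right (by omega : #A + #A - 1 ≤ p)] at hcd0
  have hℓk' : #(A - A) + 4 ≤ 3 * #A' := by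
    have h' : ((#(A - A) + 3 : ℕ) : ℝ) < ((3 * #A' : ℕ) : ℝ) := by
      push_cast
      have : K * #A ≤ 3 * (#A' : ℝ) := hAP
      linarith
    have := Nat.cast_lt.1 h'
    omega
  have hk'3 : 3 ≤ #A' := by omega
  have h12k' : 12 * #A' ≤ p := by omega
  have hA'ne : A'.Nonempty := card_pos.1 (by omega)
  have hpodd : p % 2 = 1 := by
    rcases hp'.eq_two_or_odd with h2 | h2
    · omega
    · exact h2
  /- `a = u + s_a • v` with `0 ≤ s_a ≤ (p − 1)/2` for `a ∈ A'` -/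
  set sfun : ZMod p → ℤ := fun a => ((((a - u) * v⁻¹).val : ℕ) : ℤ) with hsfun
  have hscast : ∀ a : ZMod p, ((sfun a : ℤ) : ZMod p) = (a - u) * v⁻¹ := by
    intro a
    simp only [hsfun, Int.cast_natCast, ZMod.natCast_zmod_val]
  have hs0 : ∀ a, 0 ≤ sfun a := fun a => by simp only [hsfun]; positivity
  have hsp : ∀ a, sfun a < p := fun a => by simp only [hsfun]; exact_mod_cast ZMod.val_lt _
  have hslt : ∀ a ∈ A', 2 * sfun a < p := by
    intro a ha
    obtain ⟨i, hi, hia⟩ := mem_apFinset.1 (mem_inter.1 ha).2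
    have hip : i < p := by omega
    have hsa : sfun a = i := by
      simp only [hsfun]
      rw [← hia, add_sub_cancel_left, nsmul_eq_mul, mul_assoc, mul_inv_cancel₀ hv, mul_one,
        ZMod.val_natCast, Nat.mod_eq_of_lt hip]
    rw [hsa]
    have : 2 * i < p := by omega
    exact_mod_cast this
  set S' : Finset ℤ := A'.image sfun with hS'
  have hφ₁s : ∀ a : ZMod p, u + v * ((sfun a : ℤ) : ZMod p) = a := by
    intro a
    rw [hscast, mul_comm (a - u), ← mul_assoc, mul_inv_cancel₀ hv, one_mul, add_sub_cancel]
  have hS'A' : S'.image (fun n : ℤ => u + v * (n : ZMod p)) = A' := by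
    rw [hS', Finset.image_image]
    have : ((fun n : ℤ => u + v * (n : ZMod p)) ∘ sfun) = id := funext fun a => hφ₁s a
    rw [this, Finset.image_id]
  have hcardS' : #S' = #A' := by
    refine le_antisymm card_image_le ?_
    calc #A' = #(S'.image (fun n : ℤ => u + v * (n : ZMod p))) := by rw [hS'A']
      _ ≤ #S' := card_image_le
  have hS'ne : S'.Nonempty := by rw [← card_pos, hcardS']; omega
  have hS'bd : ∀ n ∈ S', 0 ≤ n ∧ 2 * n < p := by
    intro n hn
    obtain ⟨a, ha, rfl⟩ := mem_image.1 hn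
    exact ⟨hs0 a, hslt a ha⟩
  have hcard2S' : #(S' - S') = #(A' - A') := by
    rw [← card_image_affine_sub S' u v hv hS'bd, hS'A']
  have h2S'le : #(S' - S') ≤ #(A - A) := by
    rw [hcard2S']
    exact card_le_card (sub_subset_sub hA'sub hA'sub)
  /- Freiman `3k − 4` for `(S', −S')` -/
  have h3k4S' : (#(S' + -S') : ℤ) ≤ 3 * #S' - 4 := by
    rw [← sub_eq_add_neg, hcardS']
    omega
  obtain ⟨d, hd, hsubS', -⟩ := freiman_3k4_add hS'ne hS'ne.neg (by rw [card_neg]) h3k4S'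
  rw [← sub_eq_add_neg] at hsubS'
  set a₀ : ℤ := S'.min' hS'ne with ha₀
  have hmemS' : ∀ a ∈ A', ∃ i : ℕ, i < #(S' - S') - #S' + 1 ∧ a₀ + i * d = sfun a := by
    intro a ha
    obtain ⟨i, hi, he⟩ := mem_image.1 (hsubS' (mem_image_of_mem sfun ha))
    exact ⟨i, mem_range.1 hi, he⟩
  have hdp : (d : ZMod p) ≠ 0 := by
    intro hd0
    obtain ⟨a₁, ha₁, a₂, ha₂, hne⟩ := one_lt_card.1 (by omega : 1 < #A')
    obtain ⟨i₁, _, he₁⟩ := hmemS' a₁ ha₁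
    obtain ⟨i₂, _, he₂⟩ := hmemS' a₂ ha₂
    have hcast : ((sfun a₁ : ℤ) : ZMod p) = ((sfun a₂ : ℤ) : ZMod p) := by
      rw [← he₁, ← he₂]
      push_cast
      rw [hd0]
      ring
    have heq := int_eq_of_zmodCast_eq' (p := p) (hs0 a₁) (hsp a₁) (hs0 a₂) (hsp a₂) hcast
    have h1 := hφ₁s a₁
    rw [heq, hφ₁s a₂] at h1
    exact hne h1.symm
  set u₂ : ZMod p := u + v * (a₀ : ZMod p) with hu₂
  set v₂ : ZMod p := v * (d : ZMod p) with hv₂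
  have hv₂0 : v₂ ≠ 0 := mul_ne_zero hv hdp
  set tfun : ZMod p → ℕ := fun a => ((a - u₂) * v₂⁻¹).val with htfun
  have htkey : ∀ a : ZMod p, u₂ + v₂ * (tfun a : ZMod p) = a := by
    intro a
    simp only [htfun, ZMod.natCast_zmod_val]
    rw [mul_comm (a - u₂), ← mul_assoc, mul_inv_cancel₀ hv₂0, one_mul, add_sub_cancel]
  have htlt : ∀ a, tfun a < p := fun a => ZMod.val_lt _
  have htA' : ∀ a ∈ A', tfun a + 4 ≤ 2 * #A' := by
    intro a ha
    obtain ⟨i, hi, he⟩ := hmemS' a ha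
    have ha_eq : a = u₂ + v₂ * (i : ZMod p) := by
      have h1 := hφ₁s a
      rw [← he] at h1
      push_cast at h1
      rw [← h1, hu₂, hv₂]
      ring
    have hip : i < p := by omega
    have hti : tfun a = i := by
      simp only [htfun]
      rw [ha_eq, add_sub_cancel_left, mul_comm v₂ (i : ZMod p), mul_assoc, mul_inv_cancel₀ hv₂0,
        mul_one, ZMod.val_natCast, Nat.mod_eq_of_lt hip]
    omega
  /- the `t*`-argument with `(A' − A') ∪ (a* − A') ⊆ A − A` -/
  have hsubAA : A' + -A' ⊆ A - A := by
    rw [← sub_eq_add_neg]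
    exact sub_subset_sub hA'sub hA'sub
  have htwindow : ∀ a ∈ A, tfun a + 8 ≤ 4 * #A' ∨ p + 4 ≤ tfun a + 2 * #A' := by
    intro aS haS
    by_contra hcon
    push Not at hcon
    obtain ⟨hlo, hhi⟩ := hcon
    have hdisj : Disjoint (A' + -A') ({aS} + -A') := by
      rw [Finset.disjoint_left]
      intro x hx1 hx2
      obtain ⟨a₁, ha₁, b₂, hb₂, rfl⟩ := mem_add.1 hx1
      obtain ⟨a₂, ha₂, rfl⟩ := mem_neg.1 hb₂
      obtain ⟨a₃, ha₃, b₄, hb₄, he⟩ := mem_add.1 hx2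
      rw [mem_singleton] at ha₃
      obtain ⟨a₄, ha₄, rfl⟩ := mem_neg.1 hb₄
      rw [ha₃] at he
      -- `a₁ - a₂ = aS - a₄`
      have e : ((tfun a₁ + tfun a₄ : ℕ) : ZMod p) = ((tfun aS + tfun a₂ : ℕ) : ZMod p) := by
        have hvv : v₂ * ((tfun a₁ + tfun a₄ : ℕ) : ZMod p) =
            v₂ * ((tfun aS + tfun a₂ : ℕ) : ZMod p) := by
          have h1 := htkey a₁
          have h2 := htkey a₂
          have h3 := htkey aS
          have h4 := htkey a₄
          push_cast
          linear_combination h1 - h2 - h3 + h4 - he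
        exact mul_left_cancel₀ hv₂0 hvv
      rw [ZMod.natCast_eq_natCast_iff'] at e
      have ht₁ := htA' a₁ ha₁
      have ht₂ := htA' a₂ ha₂
      have ht₄ := htA' a₄ ha₄
      rw [Nat.mod_eq_of_lt (by omega), Nat.mod_eq_of_lt (by omega)] at e
      omega
    have hunion : #(A' + -A') + #({aS} + -A') ≤ #(A - A) := by
      rw [← card_union_of_disjoint hdisj]
      refine card_le_card (union_subset hsubAA ?_)
      rw [← sub_eq_add_neg]
      exact sub_subset_sub (singleton_subset_iff.2 haS) hA'sub
    have hcd := ZMod.cauchy_davenport hp' hA'ne hA'ne.neg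
    rw [card_neg, min_eq_right (by omega : #A' + #A' - 1 ≤ p)] at hcd
    rw [card_singleton_add, card_neg] at hunion
    omega
  /- `a = u₃ + v₂ w_a` with `0 ≤ w_a ≤ 6k' − 12 < p/2`; Freiman for `(W, −W)` -/
  set L : ℤ := 2 * (#A' : ℤ) - 4 with hL
  set wfun : ZMod p → ℤ := fun a =>
    if (tfun a : ℤ) + 8 ≤ 4 * #A' then (tfun a : ℤ) + L else (tfun a : ℤ) + L - p with hwfun
  have hwbd : ∀ a ∈ A, 0 ≤ wfun a ∧ 2 * wfun a < p := by
    intro a ha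
    have ht := htlt a
    rcases htwindow a ha with h | h
    · have h' : (tfun a : ℤ) + 8 ≤ 4 * #A' := by exact_mod_cast h
      have e : wfun a = (tfun a : ℤ) + L := by simp only [hwfun, if_pos h']
      rw [e, hL]
      constructor <;> omega
    · have h' : ¬ ((tfun a : ℤ) + 8 ≤ 4 * #A') := by omega
      have e : wfun a = (tfun a : ℤ) + L - p := by simp only [hwfun, if_neg h']
      rw [e, hL]
      constructor <;> omega
  have hwcast : ∀ a, ((wfun a : ℤ) : ZMod p) = (tfun a : ZMod p) + (L : ZMod p) := by
    intro a
    by_cases h' : (tfun a : ℤ) + 8 ≤ 4 * #A'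
    · have e : wfun a = (tfun a : ℤ) + L := by simp only [hwfun, if_pos h']
      rw [e]
      push_cast
      ring
    · have e : wfun a = (tfun a : ℤ) + L - p := by simp only [hwfun, if_neg h']
      rw [e]
      push_cast
      rw [ZMod.natCast_self]
      ring
  set u₃ : ZMod p := u₂ - v₂ * (L : ZMod p) with hu₃
  have hwkey : ∀ a, u₃ + v₂ * ((wfun a : ℤ) : ZMod p) = a := by
    intro a
    rw [hwcast, hu₃]
    have := htkey a
    linear_combination this
  set W : Finset ℤ := A.image wfun with hW
  have hWA : W.image (fun n : ℤ => u₃ + v₂ * (n : ZMod p)) = A := by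
    rw [hW, Finset.image_image]
    have : ((fun n : ℤ => u₃ + v₂ * (n : ZMod p)) ∘ wfun) = id := funext fun a => hwkey a
    rw [this, Finset.image_id]
  have hcardW : #W = #A := by
    refine le_antisymm card_image_le ?_
    calc #A = #(W.image (fun n : ℤ => u₃ + v₂ * (n : ZMod p))) := by rw [hWA]
      _ ≤ #W := card_image_le
  have hWne : W.Nonempty := by rw [← card_pos, hcardW]; exact card_pos.2 hAne
  have hWbd : ∀ n ∈ W, 0 ≤ n ∧ 2 * n < p := by
    intro n hn
    obtain ⟨a, ha, rfl⟩ := mem_image.1 hn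
    exact hwbd a ha
  have hcard2W : #(W - W) = #(A - A) := by
    rw [← card_image_affine_sub W u₃ v₂ hv₂0 hWbd, hWA]
  have hℓ3k : #(A - A) + 4 ≤ 3 * #A := by omega
  have h3k4W : (#(W + -W) : ℤ) ≤ 3 * #W - 4 := by
    rw [← sub_eq_add_neg, hcard2W, hcardW]
    omega
  obtain ⟨d₁, _, hsubW, -⟩ := freiman_3k4_add hWne hWne.neg (by rw [card_neg]) h3k4W
  rw [← sub_eq_add_neg, hcard2W, hcardW] at hsubW
  set a₁ : ℤ := W.min' hWne with ha₁
  have hincl : A ⊆ apFinset (u₃ + v₂ * (a₁ : ZMod p)) (v₂ * (d₁ : ZMod p)) (#(A - A) - #A + 1) := by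
    intro x hx
    rw [← hWA] at hx
    obtain ⟨w, hw, rfl⟩ := mem_image.1 hx
    obtain ⟨i, hi, he⟩ := mem_image.1 (hsubW hw)
    rw [mem_apFinset]
    refine ⟨i, mem_range.1 hi, ?_⟩
    rw [← he]
    push_cast
    rw [nsmul_eq_mul]
    ring
  refine ⟨_, _, fun hD => ?_, hincl⟩
  rw [hD] at hincl
  have : #A ≤ 1 := by
    refine card_le_one.2 fun x hx y hy => ?_
    obtain ⟨i, _, hi⟩ := mem_apFinset.1 (hincl hx)
    obtain ⟨j, _, hj⟩ := mem_apFinset.1 (hincl hy)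
    rw [smul_zero, add_zero] at hi hj
    rw [← hi, ← hj]
  omega

open FreimanVosper in
/-- **Corollary 1 for differences** (Lev–Shkredov 2020, Corollary 1 with `A − A`): `|A| < p/12`,
`|A − A| < K|A| − 3`, a nonprincipal Fourier coefficient `|Â(z)| ≥ η|A|` with `(1+η)/2 ≥ K/3`
⇒ `A` lies in a progression with at most `|A−A| − |A| + 1` terms. [cite: LevShkredov2020, Cor 1] -/
theorem ap_of_large_fourier_coeff_sub {p : ℕ} [hp : Fact p.Prime] {A : Finset (ZMod p)} {K η : ℝ}
    (h12 : 12 * #A < p) (h2A : (#(A - A) : ℝ) < K * #A - 3)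
    (hηK : K / 3 ≤ (1 + η) / 2) {z : ZMod p} (hz0 : z ≠ 0)
    (hz : η * #A ≤ ‖∑ a ∈ A, (ZMod.stdAddChar (a * z) : ℂ)‖) :
    ∃ a d : ZMod p, d ≠ 0 ∧ A ⊆ apFinset a d (#(A - A) - #A + 1) := by
  classical
  set α : ZMod p → ℝ := fun a => ((a * z).val : ℝ) / p with hα
  have hexp : ∀ a : ZMod p,
      (ZMod.stdAddChar (a * z) : ℂ) = Complex.exp (2 * π * Complex.I * (α a : ℝ)) := by
    intro a
    rw [ZMod.stdAddChar_apply, ZMod.toCircle_apply]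
    congr 1
    simp only [hα]
    push_cast
    ring
  have h29 : η * #A ≤ ‖∑ a ∈ A, Complex.exp (2 * π * Complex.I * (α a : ℝ))‖ := by
    simp_rw [← hexp]
    exact hz
  obtain ⟨β, hβ⟩ := exists_le_card_halfArc A α η h29
  set A' : Finset (ZMod p) := A.filter (fun a => ∃ m : ℤ, β ≤ α a + m ∧ α a + m < β + 1 / 2)
    with hA'
  have hsub : A' ⊆ apFinset (z⁻¹ * ((⌈β * p⌉ : ℤ) : ZMod p)) z⁻¹ ((p + 1) / 2) :=
    subset_apFinset_of_halfArc hz0 β A' fun a ha => (mem_filter.1 ha).2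
  have hA'sub : A' ⊆ A := filter_subset _ _
  have hcard : (#A' : ℝ) ≤ #(A ∩ apFinset (z⁻¹ * ((⌈β * p⌉ : ℤ) : ZMod p)) z⁻¹ ((p + 1) / 2)) := by
    exact_mod_cast card_le_card (subset_inter hA'sub hsub)
  refine freiman_rectification_sub (u := z⁻¹ * ((⌈β * p⌉ : ℤ) : ZMod p)) h12 h2A (inv_ne_zero hz0) ?_
  have hk0 : (0 : ℝ) ≤ #A := by positivity
  have e : (1 + η) * #A / 2 ≤ #A' := hβ
  nlinarith


/-! ## Theorem 3 -/

open FreimanVosper in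
/-- **Lev–Shkredov 2020, Theorem 3.**  "Let `p` be a prime, and suppose that `A ⊆ 𝔽_p` satisfies
`|A| < 0.0045p`.  If `|A−A| < 2.6|A| − 3`, then `A` is contained in an arithmetic progression with
at most `|A−A| − |A| + 1` terms."  Proof as printed (§3) WITH THE BOOKKEEPING OF THE LOWER BOUND
CORRECTED (module docstring; `LevShkredov.addEnergy_sub_lower`, `LevShkredov.numerics_sub`):
`|A| ≤ 4` by Cauchy–Davenport and Vosper (only `|A| = 4`, `|A − A| = 7` is possible, and then
`vosper_inverse` for `(A, −A)`); for `|A| ≥ 5`, if some nonprincipal `|Â(z)| ≥ η₀|A|`,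
`η₀ = (2/3)·2.6 − 1 = 11/15`, Corollary 1 for differences (`ap_of_large_fourier_coeff_sub`,
`K = 2.6`) concludes; otherwise the Fourier bound `LevShkredov.card_mul_addEnergy_le` for
`(A, A − A)`, the corrected chain `LevShkredov.addEnergy_sub_lower`, Lemma 4
`LevShkredov.addEnergy_lower_of_few_differences` and `LevShkredov.numerics_sub` are contradictory.
[cite: LevShkredov2020, Thm 3] -/
theorem lev_shkredov_diff {p : ℕ} [hp : Fact p.Prime] {A : Finset (ZMod p)}
    (hAp : (#A : ℝ) < 0.0045 * p) (h2A : (#(A - A) : ℝ) < 2.6 * #A - 3) :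
    ∃ a d : ZMod p, d ≠ 0 ∧ A ⊆ apFinset a d (#(A - A) - #A + 1) := by
  classical
  have hp' := hp.out
  have hp0 : (0 : ℝ) < p := by exact_mod_cast hp'.pos
  have h12 : 12 * #A < p := by
    have : (12 : ℝ) * #A < p := by linarith
    exact_mod_cast this
  have hAne : A.Nonempty := by
    rw [← card_pos]
    by_contra h0
    push Not at h0
    have : #A = 0 := by omega
    rw [this] at h2A
    simp at h2A
    have : (0 : ℝ) ≤ #(A - A) := by positivity
    linarith
  have hA1 : 1 ≤ #A := card_pos.2 hAne
  have hcd := ZMod.cauchy_davenport hp' hAne hAne.neg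
  rw [card_neg, ← sub_eq_add_neg, min_eq_right (by omega : #A + #A - 1 ≤ p)] at hcd
  have hcd' : 2 * (#A : ℝ) - 1 ≤ #(A - A) := by
    have : ((#A + #A - 1 : ℕ) : ℝ) ≤ #(A - A) := by exact_mod_cast hcd
    rw [Nat.cast_sub (by omega)] at this
    push_cast at this
    linarith
  by_cases h5 : 5 ≤ #A
  · by_cases hbias : ∃ z : ZMod p, z ≠ 0 ∧
        (11 / 15 : ℝ) * #A ≤ ‖∑ a ∈ A, (ZMod.stdAddChar (a * z) : ℂ)‖
    · obtain ⟨z, hz0, hz⟩ := hbias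
      exact ap_of_large_fourier_coeff_sub (K := 2.6) (η := 11 / 15) h12 h2A (by norm_num) hz0 hz
    · push Not at hbias
      exfalso
      have hθ : ∀ x : ZMod p, x ≠ 0 →
          ‖∑ a ∈ A, (ZMod.stdAddChar (a * x) : ℂ)‖ ≤ (11 / 15 : ℝ) * #A :=
        fun x hx => (hbias x hx).le
      have hU := LevShkredov.card_mul_addEnergy_le A (A - A) hθ
      have hL := LevShkredov.addEnergy_sub_lower hAne (by omega : 2 * #A ≤ p)
      have h2D : 2 * #(A - A) < p := by
        have : (2 : ℝ) * #(A - A) < p := by nlinarith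
        exact_mod_cast this
      have hL4 := LevShkredov.addEnergy_lower_of_few_differences hAne h2D
      have hL' : ((#A : ℝ)) ^ 3 + (A.addEnergy A : ℝ) + #A + #A * #(A - A) ≤
          (A.addEnergy (A - A) : ℝ) + 3 * (#A : ℝ) ^ 2 := by exact_mod_cast hL
      have ha : (5 : ℝ) ≤ #A := by exact_mod_cast h5
      exact LevShkredov.numerics_sub (a := #A) (d := #(A - A)) (e := A.addEnergy A)
        (f := A.addEnergy (A - A)) hp0 ha hcd' h2A.le hAp.le (by linarith [hU]) hL' hL4
  · -- `|A| ≤ 4`: only `|A| = 4`, `|A − A| = 7` is compatible with Cauchy–Davenport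
    push Not at h5
    have ha4 : #A = 4 := by
      have : (3 : ℝ) < #A := by linarith
      have : 3 < #A := by exact_mod_cast this
      omega
    have hd7 : #(A - A) = 7 := by
      rw [ha4] at h2A
      have : (#(A - A) : ℝ) < 8 := by linarith
      have : #(A - A) < 8 := by exact_mod_cast this
      omega
    have hcrit : #(A + -A) = #A + #(-A) - 1 := by
      rw [← sub_eq_add_neg, card_neg, hd7, ha4]
    have hsmall : #(A + -A) ≤ p - 2 := by
      rw [← sub_eq_add_neg, hd7]
      omega
    obtain ⟨d, hd0, hAP, -⟩ := vosper_inverse (by omega) (by rw [card_neg]; omega) hcrit hsmall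
    obtain ⟨a₀, hAeq⟩ := hAP
    refine ⟨a₀, d, hd0, ?_⟩
    have hlen : #(A - A) - #A + 1 = #A := by omega
    intro x hx
    rw [hlen]
    rw [hAeq] at hx
    exact hx


end Literature.Combinatorics.Additive
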